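import Literature.NumberTheory.Sieve.BombieriFriedlanderIwaniecTheorem5StarBoxes
import Literature.NumberTheory.Sieve.TwoRangeSieveWeights
import Literature.NumberTheory.Sieve.CoprimeSquarefreeSums
import HarnessLib

/-!
# Bombieri–Friedlander–Iwaniec 1986: Theorem 5* from Theorem 5

Topic `Literature/NumberTheory/Sieve`.  Everything here is PROVED.  Main result:

* `Literature.NumberTheory.Sieve.BombieriFriedlanderIwaniecTheorem5StarInterval_of_theorem5` —
  the named fact `…BombieriFriedlanderIwaniecTheorem5StarInterval` (BFI Theorem 5* as applied in
  §15: coefficients `1_{(M₁,M₂]} · 1_{(·,P(z))=1}`, every `z ≤ exp(log x/log log x)`, saving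
  `ℒ^{−A}` for every `A`) FOLLOWS from the named fact `…BombieriFriedlanderIwaniecTheorem5` (the
  printed Theorem 5, §12 p. 237, `α ≡ 1`, power saving).  With `…Interval.theorem5Star`, the
  printed Theorem 5* follows from the printed Theorem 5 as well
  (`Literature.NumberTheory.Sieve.BombieriFriedlanderIwaniecTheorem5Star_of_theorem5`); so the
  leaves under BFI's Theorem 10 in the tree reduce to Theorems 1, 2 and 5.

Source: E. Bombieri, J. B. Friedlander, H. Iwaniec, *Primes in arithmetic progressions to large
moduli*, Acta Math. 156 (1986), 203–251, §12, p. 238: "Theorem 5* can be easily derived from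
Theorem 5 by means of a sieve method of Fundamental Lemma type … we obtain
`E⁻(M,N;q,a) − Δ(M,N;q) ≤ E(M,N;q,a) ≤ E⁺(M,N;q,a) + Δ(M,N;q)` … Theorem 5 is applicable to `E_d`
giving `E_d ≪ ‖β‖x^{1/2−ε}M^{1/2}` … This completes the proof of Theorem 5*."

## The proof (the printed argument, made effective)

1. **Signs** (`BFI.abs_dispD_le_of_nonneg`): `𝒟` is trilinear in `β, γ, δ`; split each into its
   positive and negative parts, so that `β, γ, δ ≥ 0` (the print assumes `β ≥ 0` and leaves the
   signs of `γ_q δ_r` implicit).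
2. **Rows** (`BFI.rowF_eq_rowA_sub_rowB`): `𝒟 = ∑_m α_m F(m)` with `F = F_A − F_B`, congruence part
   minus expected part, both `≥ 0`.
3. **Sieve** (`BFI.abs_sum_sandwich_le`, `BFI.core_sieve_step`): with weights `L ≤ 1_{(·,P(z))=1} ≤ U`
   of level `D`, `|∑ 1_{rough} F| ≤ |∑ U F| + |∑ L F| + ∑ (U − L) F_B`; the first two are
   `∑_d w_d 𝒟_d` with `𝒟_d = ∑_{d∣m} F(m)` = `𝒟` at the scale `(M/d, dN)` (`BFI.rowF_mul_left`,
   `β'_{n'} = β_{n'/d} 1_{d∣n'}`, `‖β'‖ = ‖β‖`), bounded by Theorem 5 on boxes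
   (`…Theorem5.interval`, `BFI.abs_sum_filter_dvd_rowF_le`); the third is the remainder `Δ`,
   `≤ ‖β‖₁ ∑_{q,r} γ_qδ_r φ(qr)⁻¹ ∑_{(m,qr)=1}(U − L)(m)`, evaluated by counting integers coprime to
   `qr` in progressions (`BFI.abs_card_dvd_coprime_sub_le`) against the sieve main terms for the
   density `g_{qr}(d) = 1_{(d,qr)=1}/d` (`BFI.sum_UL_coprime_le`, `BFI.sum_UL_rowB_le`).
4. **Which sieve.**  The level must be a small power `D ≤ x^{ε_s/4}` (Theorem 5 saves only
   `x^{−ε_s}` and the weights are summed absolutely), while `z` may be as large as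
   `exp(log x/log log x)`, so `s = log D/log z ≍ log log x` and the remainder must still be
   `≪ ℒ^{−A−c}`: a Fundamental Lemma of quality `e^{−s}` (the tree's beta-sieve) is NOT enough, one
   needs `exp(−s log s)` (BFI's Lemma 4).  We use the two-range composite weights of
   `Literature.NumberTheory.Sieve.TwoRangeSieve` (`TwoRangeSieveWeights.lean`): beta-sieve below
   `z₁ = min(z, exp(ε_s ℒ/(80 A' log ℒ)))` (so `s₁ ≥ 10A' log ℒ`, error `≤ ℒ^{−A'}`) and Brun's pure
   sieve to depth `2r+1 ≍ (ε_s/8) log ℒ` on `[z₁, z)` (a range with `∑ 1/p = O(1)`, Bonferroni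
   tail `(e log Λ'/(2r+1))^{2r+1} ≤ ℒ^{−A'}` once `log log log x` is large — `BFI.core_params`,
   `BFI.tail_pow_le`); level `x^{ε_s/8} z^{2r+1} ≤ x^{ε_s/4}`.
5. **Numerics** (`BFI.core_numerics`, `BFI.core_bound`): the three terms are each
   `≤ ½ ‖β‖x^{1/2}M^{1/2}ℒ^{−A}` for `x ≥ x₀(a, ε, A, B)`.

## References

* E. Bombieri, J. B. Friedlander, H. Iwaniec, *Primes in arithmetic progressions to large moduli*,
  Acta Math. 156 (1986), 203–251: §2 Lemma 4 p. 211; §12 Theorem 5 p. 237, Theorem 5* and its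
  proof p. 238; §15 p. 246. [BombieriFriedlanderIwaniecActa1986]
-/

open Finset Real
open scoped ArithmeticFunction.sigma ArithmeticFunction.Moebius

namespace Literature.NumberTheory.Sieve

namespace BFI

/-! ### Linearity of the rows in `β`, `γ`, `δ` -/

/-- `F` is additive in `β`: `F_{β₁−β₂} = F_{β₁} − F_{β₂}`. [folklore] -/
theorem rowF_sub_beta (a : ℤ) (N Q R : ℝ) (β₁ β₂ γ δ : ℕ → ℝ) (m : ℕ) :
    rowF a N Q R (fun n => β₁ n - β₂ n) γ δ m = rowF a N Q R β₁ γ δ m - rowF a N Q R β₂ γ δ m := by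
  unfold rowF
  rw [← Finset.sum_sub_distrib]
  refine Finset.sum_congr rfl fun q _ => ?_
  rw [← Finset.sum_sub_distrib]
  refine Finset.sum_congr rfl fun r _ => ?_
  split_ifs with h
  · have h1 : (∑ n ∈ dyadic N, if ((m * n : ℕ) : ZMod (q * r)) = (a : ZMod (q * r)) then β₁ n - β₂ n else 0) =
        (∑ n ∈ dyadic N, if ((m * n : ℕ) : ZMod (q * r)) = (a : ZMod (q * r)) then β₁ n else 0) -
        (∑ n ∈ dyadic N, if ((m * n : ℕ) : ZMod (q * r)) = (a : ZMod (q * r)) then β₂ n else 0) := by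
      rw [← Finset.sum_sub_distrib]
      exact Finset.sum_congr rfl fun n _ => by split_ifs <;> ring
    have h2 : (∑ n ∈ dyadic N, if (m * n).Coprime (q * r) then β₁ n - β₂ n else 0) =
        (∑ n ∈ dyadic N, if (m * n).Coprime (q * r) then β₁ n else 0) -
        (∑ n ∈ dyadic N, if (m * n).Coprime (q * r) then β₂ n else 0) := by
      rw [← Finset.sum_sub_distrib]
      exact Finset.sum_congr rfl fun n _ => by split_ifs <;> ring
    rw [h1, h2]; ring
  · ring

/-- `F` is additive in `γ`. [folklore] -/
theorem rowF_sub_gamma (a : ℤ) (N Q R : ℝ) (β γ₁ γ₂ δ : ℕ → ℝ) (m : ℕ) :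
    rowF a N Q R β (fun q => γ₁ q - γ₂ q) δ m = rowF a N Q R β γ₁ δ m - rowF a N Q R β γ₂ δ m := by
  unfold rowF
  rw [← Finset.sum_sub_distrib]
  refine Finset.sum_congr rfl fun q _ => ?_
  rw [← Finset.sum_sub_distrib]
  refine Finset.sum_congr rfl fun r _ => ?_
  split_ifs <;> ring

/-- `F` is additive in `δ`. [folklore] -/
theorem rowF_sub_delta (a : ℤ) (N Q R : ℝ) (β γ δ₁ δ₂ : ℕ → ℝ) (m : ℕ) :
    rowF a N Q R β γ (fun r => δ₁ r - δ₂ r) m = rowF a N Q R β γ δ₁ m - rowF a N Q R β γ δ₂ m := by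
  unfold rowF
  rw [← Finset.sum_sub_distrib]
  refine Finset.sum_congr rfl fun q _ => ?_
  rw [← Finset.sum_sub_distrib]
  refine Finset.sum_congr rfl fun r _ => ?_
  split_ifs <;> ring

/-- `𝒟` is additive in `β`. [folklore] -/
theorem dispD_sub_beta (a : ℤ) (M N Q R : ℝ) (α β₁ β₂ γ δ : ℕ → ℝ) :
    dispD a M N Q R α (fun n => β₁ n - β₂ n) γ δ = dispD a M N Q R α β₁ γ δ - dispD a M N Q R α β₂ γ δ := by
  simp only [dispD_eq_sum_rowF, rowF_sub_beta, mul_sub, Finset.sum_sub_distrib]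

/-- `𝒟` is additive in `γ`. [folklore] -/
theorem dispD_sub_gamma (a : ℤ) (M N Q R : ℝ) (α β γ₁ γ₂ δ : ℕ → ℝ) :
    dispD a M N Q R α β (fun q => γ₁ q - γ₂ q) δ = dispD a M N Q R α β γ₁ δ - dispD a M N Q R α β γ₂ δ := by
  simp only [dispD_eq_sum_rowF, rowF_sub_gamma, mul_sub, Finset.sum_sub_distrib]

/-- `𝒟` is additive in `δ`. [folklore] -/
theorem dispD_sub_delta (a : ℤ) (M N Q R : ℝ) (α β γ δ₁ δ₂ : ℕ → ℝ) :
    dispD a M N Q R α β γ (fun r => δ₁ r - δ₂ r) = dispD a M N Q R α β γ δ₁ - dispD a M N Q R α β γ δ₂ := by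
  simp only [dispD_eq_sum_rowF, rowF_sub_delta, mul_sub, Finset.sum_sub_distrib]

/-! ### Positive and negative parts -/

/-- The positive part `f⁺ = max(f, 0)`. [folklore] -/
noncomputable def posPt (f : ℕ → ℝ) : ℕ → ℝ := fun n => max (f n) 0

/-- The negative part `f⁻ = max(−f, 0)`. [folklore] -/
noncomputable def negPt (f : ℕ → ℝ) : ℕ → ℝ := fun n => max (-f n) 0

/-- `f = f⁺ − f⁻`. [folklore] -/
theorem posPt_sub_negPt (f : ℕ → ℝ) : (fun n => posPt f n - negPt f n) = f := by
  funext n; unfold posPt negPt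
  rcases le_total (f n) 0 with h | h
  · rw [max_eq_right h, max_eq_left (by linarith)]; ring
  · rw [max_eq_left h, max_eq_right (by linarith)]; ring

/-- `f⁺ ≥ 0`. [folklore] -/
theorem posPt_nonneg (f : ℕ → ℝ) (n : ℕ) : 0 ≤ posPt f n := le_max_right _ _
/-- `f⁻ ≥ 0`. [folklore] -/
theorem negPt_nonneg (f : ℕ → ℝ) (n : ℕ) : 0 ≤ negPt f n := le_max_right _ _

/-- `|f⁺| ≤ |f|`. [folklore] -/
theorem abs_posPt_le (f : ℕ → ℝ) (n : ℕ) : |posPt f n| ≤ |f n| := by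
  unfold posPt
  rw [abs_of_nonneg (le_max_right _ _)]
  exact max_le (le_abs_self _) (abs_nonneg _)

/-- `|f⁻| ≤ |f|`. [folklore] -/
theorem abs_negPt_le (f : ℕ → ℝ) (n : ℕ) : |negPt f n| ≤ |f n| := by
  unfold negPt
  rw [abs_of_nonneg (le_max_right _ _)]
  exact max_le (neg_le_abs _) (abs_nonneg _)

/-- `|β₁| ≤ |β₂|` pointwise implies `‖β₁‖ ≤ ‖β₂‖`. [folklore] -/
theorem l2Sq_le_of_abs_le {N : ℝ} {β₁ β₂ : ℕ → ℝ} (h : ∀ n, |β₁ n| ≤ |β₂ n|) : l2Sq N β₁ ≤ l2Sq N β₂ := by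
  unfold l2Sq
  refine Finset.sum_le_sum fun n _ => ?_
  rw [← sq_abs (β₁ n), ← sq_abs (β₂ n)]
  exact pow_le_pow_left₀ (abs_nonneg _) (h n) 2

/-- **Reduction to nonnegative coefficients.**  If a bound `|𝒟(α, β, γ, δ)| ≤ C √(l2Sq N β) X`
holds for all `β, γ, δ ≥ 0` with `|γ| ≤ G`, `|δ| ≤ H` (pointwise), then it holds with `8C` for all
real `β` and all `γ, δ` with `|γ| ≤ G`, `|δ| ≤ H` (split each of `β, γ, δ` into its positive and
negative parts; `𝒟` is trilinear). [folklore] -/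
theorem abs_dispD_le_of_nonneg {a : ℤ} {M N Q R C X : ℝ} {α : ℕ → ℝ} {G H : ℕ → ℝ} (hC : 0 ≤ C) (hX : 0 ≤ X)
    (h : ∀ β γ δ : ℕ → ℝ, (∀ n, 0 ≤ β n) → (∀ q, 0 ≤ γ q) → (∀ r, 0 ≤ δ r) →
      (∀ q, |γ q| ≤ G q) → (∀ r, |δ r| ≤ H r) →
      |dispD a M N Q R α β γ δ| ≤ C * Real.sqrt (l2Sq N β) * X)
    (β γ δ : ℕ → ℝ) (hγ : ∀ q, |γ q| ≤ G q) (hδ : ∀ r, |δ r| ≤ H r) :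
    |dispD a M N Q R α β γ δ| ≤ 8 * C * Real.sqrt (l2Sq N β) * X := by
  -- bounds for the parts
  have hb : ∀ β' : ℕ → ℝ, (∀ n, |β' n| ≤ |β n|) → Real.sqrt (l2Sq N β') ≤ Real.sqrt (l2Sq N β) :=
    fun β' hβ' => Real.sqrt_le_sqrt (l2Sq_le_of_abs_le hβ')
  have hγp : ∀ q, |posPt γ q| ≤ G q := fun q => (abs_posPt_le γ q).trans (hγ q)
  have hγn : ∀ q, |negPt γ q| ≤ G q := fun q => (abs_negPt_le γ q).trans (hγ q)
  have hδp : ∀ r, |posPt δ r| ≤ H r := fun r => (abs_posPt_le δ r).trans (hδ r)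
  have hδn : ∀ r, |negPt δ r| ≤ H r := fun r => (abs_negPt_le δ r).trans (hδ r)
  -- each of the eight pieces
  have piece : ∀ (β' γ' δ' : ℕ → ℝ), (∀ n, 0 ≤ β' n) → (∀ n, |β' n| ≤ |β n|) → (∀ q, 0 ≤ γ' q) →
      (∀ r, 0 ≤ δ' r) → (∀ q, |γ' q| ≤ G q) → (∀ r, |δ' r| ≤ H r) →
      |dispD a M N Q R α β' γ' δ'| ≤ C * Real.sqrt (l2Sq N β) * X := by
    intro β' γ' δ' hβ'0 hβ' hγ'0 hδ'0 hγ' hδ'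
    exact (h β' γ' δ' hβ'0 hγ'0 hδ'0 hγ' hδ').trans
      (mul_le_mul_of_nonneg_right (mul_le_mul_of_nonneg_left (hb β' hβ') hC) hX)
  -- expand
  have eβ := posPt_sub_negPt β
  have eγ := posPt_sub_negPt γ
  have eδ := posPt_sub_negPt δ
  have key : dispD a M N Q R α β γ δ =
      ((dispD a M N Q R α (posPt β) (posPt γ) (posPt δ) - dispD a M N Q R α (posPt β) (posPt γ) (negPt δ)) -
        (dispD a M N Q R α (posPt β) (negPt γ) (posPt δ) - dispD a M N Q R α (posPt β) (negPt γ) (negPt δ))) -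
      ((dispD a M N Q R α (negPt β) (posPt γ) (posPt δ) - dispD a M N Q R α (negPt β) (posPt γ) (negPt δ)) -
        (dispD a M N Q R α (negPt β) (negPt γ) (posPt δ) - dispD a M N Q R α (negPt β) (negPt γ) (negPt δ))) := by
    conv_lhs => rw [← eβ, ← eγ, ← eδ]
    simp only [dispD_sub_beta, dispD_sub_gamma, dispD_sub_delta]
    ring
  rw [key]
  have t1 := piece _ _ _ (posPt_nonneg β) (abs_posPt_le β) (posPt_nonneg γ) (posPt_nonneg δ) hγp hδp
  have t2 := piece _ _ _ (posPt_nonneg β) (abs_posPt_le β) (posPt_nonneg γ) (negPt_nonneg δ) hγp hδn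
  have t3 := piece _ _ _ (posPt_nonneg β) (abs_posPt_le β) (negPt_nonneg γ) (posPt_nonneg δ) hγn hδp
  have t4 := piece _ _ _ (posPt_nonneg β) (abs_posPt_le β) (negPt_nonneg γ) (negPt_nonneg δ) hγn hδn
  have t5 := piece _ _ _ (negPt_nonneg β) (abs_negPt_le β) (posPt_nonneg γ) (posPt_nonneg δ) hγp hδp
  have t6 := piece _ _ _ (negPt_nonneg β) (abs_negPt_le β) (posPt_nonneg γ) (negPt_nonneg δ) hγp hδn
  have t7 := piece _ _ _ (negPt_nonneg β) (abs_negPt_le β) (negPt_nonneg γ) (posPt_nonneg δ) hγn hδp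
  have t8 := piece _ _ _ (negPt_nonneg β) (abs_negPt_le β) (negPt_nonneg γ) (negPt_nonneg δ) hγn hδn
  have e : 8 * C * Real.sqrt (l2Sq N β) * X = 8 * (C * Real.sqrt (l2Sq N β) * X) := by ring
  rw [e]
  refine (abs_sub _ _).trans ?_
  refine (add_le_add ((abs_sub _ _).trans (add_le_add ((abs_sub _ _).trans (add_le_add t1 t2))
    ((abs_sub _ _).trans (add_le_add t3 t4)))) ((abs_sub _ _).trans (add_le_add ((abs_sub _ _).trans
    (add_le_add t5 t6)) ((abs_sub _ _).trans (add_le_add t7 t8))))).trans ?_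
  linarith

/-! ### The rows as a difference of two nonnegative parts -/

/-- The congruence part of a row: `F_A(m) = ∑_{q,r,(qr,a)=1} γ_q δ_r ∑_{n∼N, mn≡a (qr)} β_n`. [folklore] -/
noncomputable def rowA (a : ℤ) (N Q R : ℝ) (β γ δ : ℕ → ℝ) (m : ℕ) : ℝ :=
  ∑ q ∈ dyadic Q, ∑ r ∈ dyadic R,
    if IsCoprime ((q * r : ℕ) : ℤ) a then
      γ q * δ r * (∑ n ∈ dyadic N, if ((m * n : ℕ) : ZMod (q * r)) = (a : ZMod (q * r)) then β n else 0)
    else 0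

/-- The expected part of a row: `F_B(m) = ∑_{q,r,(qr,a)=1} γ_q δ_r φ(qr)⁻¹ ∑_{n∼N, (mn,qr)=1} β_n`. [folklore] -/
noncomputable def rowB (a : ℤ) (N Q R : ℝ) (β γ δ : ℕ → ℝ) (m : ℕ) : ℝ :=
  ∑ q ∈ dyadic Q, ∑ r ∈ dyadic R,
    if IsCoprime ((q * r : ℕ) : ℤ) a then
      γ q * δ r * ((∑ n ∈ dyadic N, if (m * n).Coprime (q * r) then β n else 0) / (Nat.totient (q * r) : ℝ))
    else 0

/-- `F = F_A − F_B`. [folklore] -/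
theorem rowF_eq_rowA_sub_rowB (a : ℤ) (N Q R : ℝ) (β γ δ : ℕ → ℝ) (m : ℕ) :
    rowF a N Q R β γ δ m = rowA a N Q R β γ δ m - rowB a N Q R β γ δ m := by
  unfold rowF rowA rowB
  rw [← Finset.sum_sub_distrib]
  refine Finset.sum_congr rfl fun q _ => ?_
  rw [← Finset.sum_sub_distrib]
  refine Finset.sum_congr rfl fun r _ => ?_
  split_ifs <;> ring

/-- `F_A ≥ 0` for nonnegative coefficients. [folklore] -/
theorem rowA_nonneg (a : ℤ) (N Q R : ℝ) {β γ δ : ℕ → ℝ} (hβ : ∀ n, 0 ≤ β n) (hγ : ∀ q, 0 ≤ γ q)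
    (hδ : ∀ r, 0 ≤ δ r) (m : ℕ) : 0 ≤ rowA a N Q R β γ δ m := by
  unfold rowA
  refine Finset.sum_nonneg fun q _ => Finset.sum_nonneg fun r _ => ?_
  split_ifs
  · refine mul_nonneg (mul_nonneg (hγ q) (hδ r)) (Finset.sum_nonneg fun n _ => ?_)
    split_ifs <;> [exact hβ n; exact le_rfl]
  · exact le_rfl

/-- `0 ≤ F_B(m) ≤ (∑_n β_n) ∑_{q,r} γ_q δ_r 1_{(m,qr)=1} / φ(qr)` for nonnegative coefficients. [folklore] -/
theorem rowB_nonneg_le (a : ℤ) (N Q R : ℝ) {β γ δ : ℕ → ℝ} (hβ : ∀ n, 0 ≤ β n) (hγ : ∀ q, 0 ≤ γ q)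
    (hδ : ∀ r, 0 ≤ δ r) (m : ℕ) :
    0 ≤ rowB a N Q R β γ δ m ∧ rowB a N Q R β γ δ m ≤
      (∑ n ∈ dyadic N, β n) * ∑ q ∈ dyadic Q, ∑ r ∈ dyadic R,
        γ q * δ r * (if m.Coprime (q * r) then 1 else 0) / (Nat.totient (q * r) : ℝ) := by
  have hS : ∀ q r : ℕ, 0 ≤ (∑ n ∈ dyadic N, if (m * n).Coprime (q * r) then β n else 0) ∧
      (∑ n ∈ dyadic N, if (m * n).Coprime (q * r) then β n else 0) ≤
        (if m.Coprime (q * r) then 1 else 0) * ∑ n ∈ dyadic N, β n := by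
    intro q r
    constructor
    · exact Finset.sum_nonneg fun n _ => by split_ifs <;> [exact hβ n; exact le_rfl]
    · by_cases hm : m.Coprime (q * r)
      · rw [if_pos hm, one_mul]
        exact Finset.sum_le_sum fun n _ => by split_ifs <;> [exact le_rfl; exact hβ n]
      · rw [if_neg hm, zero_mul]
        refine Finset.sum_nonpos fun n _ => ?_
        rw [if_neg (fun h => hm (Nat.Coprime.coprime_mul_right h))]
  unfold rowB
  constructor
  · refine Finset.sum_nonneg fun q _ => Finset.sum_nonneg fun r _ => ?_
    split_ifs
    · exact mul_nonneg (mul_nonneg (hγ q) (hδ r)) (div_nonneg (hS q r).1 (Nat.cast_nonneg _))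
    · exact le_rfl
  · rw [Finset.mul_sum]
    refine Finset.sum_le_sum fun q _ => ?_
    rw [Finset.mul_sum]
    refine Finset.sum_le_sum fun r _ => ?_
    have hφ : (0 : ℝ) ≤ (Nat.totient (q * r) : ℝ) := Nat.cast_nonneg _
    have hrhs : 0 ≤ (∑ n ∈ dyadic N, β n) * (γ q * δ r * (if m.Coprime (q * r) then 1 else 0) /
        (Nat.totient (q * r) : ℝ)) := by
      refine mul_nonneg (Finset.sum_nonneg fun n _ => hβ n) (div_nonneg ?_ hφ)
      exact mul_nonneg (mul_nonneg (hγ q) (hδ r)) (by positivity)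
    by_cases hc : IsCoprime ((q * r : ℕ) : ℤ) a
    · rw [if_pos hc]
      calc γ q * δ r * ((∑ n ∈ dyadic N, if (m * n).Coprime (q * r) then β n else 0) / (Nat.totient (q * r) : ℝ))
          ≤ γ q * δ r * (((if m.Coprime (q * r) then 1 else 0) * ∑ n ∈ dyadic N, β n) /
              (Nat.totient (q * r) : ℝ)) :=
            mul_le_mul_of_nonneg_left (div_le_div_of_nonneg_right (hS q r).2 hφ) (mul_nonneg (hγ q) (hδ r))
        _ = _ := by ring
    · rw [if_neg hc]; exact hrhs

/-! ### Dividing out a divisor of `m` -/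

/-- Multiples of `d` in a real box: `m ∈ (⌊u⌋, ⌊v⌋]` with `d ∣ m` are the `d m'` with
`m' ∈ (⌊u/d⌋, ⌊v/d⌋]` (`u, v ≥ 0`, `d ≥ 1`). [folklore] -/
theorem sum_Ioc_filter_dvd_eq_sum_div {u v : ℝ} (hu : 0 ≤ u) (hv : 0 ≤ v) {d : ℕ} (hd : 0 < d) (f : ℕ → ℝ) :
    ∑ m ∈ (Ioc ⌊u⌋₊ ⌊v⌋₊).filter (fun m : ℕ => d ∣ m), f m = ∑ m' ∈ Ioc ⌊u / d⌋₊ ⌊v / d⌋₊, f (d * m') := by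
  have hd' : (0 : ℝ) < d := by exact_mod_cast hd
  have hset : (Ioc ⌊u⌋₊ ⌊v⌋₊).filter (fun m : ℕ => d ∣ m) = (Ioc ⌊u / d⌋₊ ⌊v / d⌋₊).image (fun m' => d * m') := by
    ext m
    rw [Finset.mem_filter, Finset.mem_image, Finset.mem_Ioc, Nat.floor_lt hu, Nat.le_floor_iff hv]
    constructor
    · rintro ⟨⟨h1, h2⟩, ⟨m', rfl⟩⟩
      refine ⟨m', ?_, rfl⟩
      rw [Finset.mem_Ioc, Nat.floor_lt (by positivity), Nat.le_floor_iff (by positivity),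
        div_lt_iff₀ hd', le_div_iff₀ hd']
      push_cast at h1 h2
      constructor <;> nlinarith
    · rintro ⟨m', hm', rfl⟩
      rw [Finset.mem_Ioc, Nat.floor_lt (by positivity), Nat.le_floor_iff (by positivity),
        div_lt_iff₀ hd', le_div_iff₀ hd'] at hm'
      push_cast
      refine ⟨⟨by nlinarith [hm'.1], by nlinarith [hm'.2]⟩, ⟨m', rfl⟩⟩
  rw [hset, Finset.sum_image]
  intro x _ y _ h
  exact Nat.eq_of_mul_eq_mul_left hd h

/-- The `n`-substitution behind `F(d m')`: the multiples of `d` in `n' ∼ dN` are the `d n`, `n ∼ N`. [folklore] -/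
theorem sum_dyadic_mul_eq {N : ℝ} (hN : 0 ≤ N) {d : ℕ} (hd : 0 < d) (f : ℕ → ℝ) :
    ∑ n' ∈ dyadic ((d : ℝ) * N), (if d ∣ n' then f n' else 0) = ∑ n ∈ dyadic N, f (d * n) := by
  have hd' : (0 : ℝ) < d := by exact_mod_cast hd
  rw [← Finset.sum_filter]
  have hset : (dyadic ((d : ℝ) * N)).filter (fun n' : ℕ => d ∣ n') = (dyadic N).image (fun n => d * n) := by
    ext n'
    rw [Finset.mem_filter, Finset.mem_image, mem_dyadic (by positivity)]
    constructor
    · rintro ⟨⟨h1, h2⟩, ⟨n, rfl⟩⟩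
      refine ⟨n, ?_, rfl⟩
      rw [mem_dyadic hN]
      push_cast at h1 h2
      constructor <;> nlinarith
    · rintro ⟨n, hn, rfl⟩
      rw [mem_dyadic hN] at hn
      push_cast
      refine ⟨⟨by nlinarith [hn.1], by nlinarith [hn.2]⟩, ⟨n, rfl⟩⟩
  rw [hset, Finset.sum_image]
  intro x _ y _ h
  exact Nat.eq_of_mul_eq_mul_left hd h

/-- The coefficients `β'_{n'} = β_{n'/d} 1_{d ∣ n'}` on `n' ∼ dN`. [folklore] -/
noncomputable def betaMul (d : ℕ) (β : ℕ → ℝ) : ℕ → ℝ := fun n' => if d ∣ n' then β (n' / d) else 0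

/-- **`F(d m')` is a row at the scale `(M/d, dN)`**: `F_{N,β}(d m') = F_{dN, β'}(m')` with
`β' = betaMul d β` (same `x = (M/d)(dN)`), the substitution of BFI p. 238 (`E_d`). [folklore] -/
theorem rowF_mul_left (a : ℤ) {N : ℝ} (hN : 0 ≤ N) (Q R : ℝ) (β γ δ : ℕ → ℝ) {d : ℕ} (hd : 0 < d) (m' : ℕ) :
    rowF a N Q R β γ δ (d * m') = rowF a ((d : ℝ) * N) Q R (betaMul d β) γ δ m' := by
  unfold rowF
  refine Finset.sum_congr rfl fun q _ => Finset.sum_congr rfl fun r _ => ?_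
  have h1 : (∑ n ∈ dyadic ((d : ℝ) * N),
      if ((m' * n : ℕ) : ZMod (q * r)) = (a : ZMod (q * r)) then betaMul d β n else 0) =
      ∑ n ∈ dyadic N, if ((d * m' * n : ℕ) : ZMod (q * r)) = (a : ZMod (q * r)) then β n else 0 := by
    have := sum_dyadic_mul_eq hN hd
      (fun n' => if ((m' * n' : ℕ) : ZMod (q * r)) = (a : ZMod (q * r)) then β (n' / d) else 0)
    refine (Finset.sum_congr rfl fun n _ => ?_).trans (this.trans (Finset.sum_congr rfl fun n _ => ?_))
    · unfold betaMul
      by_cases hdn : d ∣ n <;> simp [hdn]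
    · rw [Nat.mul_div_cancel_left n hd, show m' * (d * n) = d * m' * n by ring]
  have h2 : (∑ n ∈ dyadic ((d : ℝ) * N), if (m' * n).Coprime (q * r) then betaMul d β n else 0) =
      ∑ n ∈ dyadic N, if (d * m' * n).Coprime (q * r) then β n else 0 := by
    have := sum_dyadic_mul_eq hN hd (fun n' => if (m' * n').Coprime (q * r) then β (n' / d) else 0)
    refine (Finset.sum_congr rfl fun n _ => ?_).trans (this.trans (Finset.sum_congr rfl fun n _ => ?_))
    · unfold betaMul
      by_cases hdn : d ∣ n <;> simp [hdn]
    · rw [Nat.mul_div_cancel_left n hd, show m' * (d * n) = d * m' * n by ring]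
  rw [h1, h2]

/-- `‖β'‖ = ‖β‖`: `l2Sq (dN) (betaMul d β) = l2Sq N β`. [folklore] -/
theorem l2Sq_betaMul {N : ℝ} (hN : 0 ≤ N) {d : ℕ} (hd : 0 < d) (β : ℕ → ℝ) :
    l2Sq ((d : ℝ) * N) (betaMul d β) = l2Sq N β := by
  unfold l2Sq
  have := sum_dyadic_mul_eq hN hd (fun n' => β (n' / d) ^ 2)
  refine (Finset.sum_congr rfl fun n _ => ?_).trans (this.trans (Finset.sum_congr rfl fun n _ => ?_))
  · unfold betaMul
    by_cases hdn : d ∣ n <;> simp [hdn]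
  · rw [Nat.mul_div_cancel_left n hd]

/-- `betaMul` preserves nonnegativity. [folklore] -/
theorem betaMul_nonneg {β : ℕ → ℝ} (hβ : ∀ n, 0 ≤ β n) (d n : ℕ) : 0 ≤ betaMul d β n := by
  unfold betaMul; split_ifs <;> [exact hβ _; exact le_rfl]

/-! ### Counting integers coprime to `k` in a box -/

/-- `|#{A < m ≤ B : (m, k) = 1} − (φ(k)/k)(B − A)| ≤ τ(k)` for `k ≥ 1` (Möbius inversion over the
divisors of `k`; `∑_{e∣k} μ(e)/e = φ(k)/k`). [folklore] -/
theorem abs_card_coprime_sub_le {k : ℕ} (hk : k ≠ 0) (A B : ℕ) (hAB : A ≤ B) :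
    |(#((Ioc A B).filter (fun m : ℕ => m.Coprime k)) : ℝ) - (Nat.totient k : ℝ) / k * ((B : ℝ) - A)| ≤
      (σ 0 k : ℝ) := by
  -- Möbius inversion
  have h1 : (#((Ioc A B).filter (fun m : ℕ => m.Coprime k)) : ℝ) =
      ∑ e ∈ k.divisors, (μ e : ℝ) * (#((Ioc A B).filter (fun m : ℕ => e ∣ m)) : ℝ) := by
    rw [Finset.card_eq_sum_ones, Nat.cast_sum, Finset.sum_filter]
    push_cast
    calc ∑ m ∈ Ioc A B, (if m.Coprime k then (1 : ℝ) else 0)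
        = ∑ m ∈ Ioc A B, ∑ e ∈ k.divisors.filter (fun e : ℕ => e ∣ m), (μ e : ℝ) := by
          refine Finset.sum_congr rfl fun m hm => ?_
          rw [Finset.mem_Ioc] at hm
          exact coprime_indicator_eq_sum_moebius (by omega) hk
      _ = ∑ m ∈ Ioc A B, ∑ e ∈ k.divisors, (if e ∣ m then (μ e : ℝ) else 0) := by
          refine Finset.sum_congr rfl fun m _ => ?_
          rw [Finset.sum_filter]
      _ = ∑ e ∈ k.divisors, ∑ m ∈ Ioc A B, (if e ∣ m then (μ e : ℝ) else 0) := Finset.sum_comm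
      _ = _ := by
          refine Finset.sum_congr rfl fun e _ => ?_
          rw [← Finset.sum_filter, Finset.sum_const, nsmul_eq_mul, mul_comm]
  -- counting multiples
  have h2 : ∀ e ∈ k.divisors, (#((Ioc A B).filter (fun m : ℕ => e ∣ m)) : ℝ) = ((B / e : ℕ) : ℝ) - ((A / e : ℕ) : ℝ) := by
    intro e he
    have he0 : 0 < e := Nat.pos_of_mem_divisors he
    have := card_filter_dvd_eq he0 A B (fun _ => True)
    simp only [and_true, Finset.filter_true] at this
    rw [this, Nat.card_Ioc, Nat.cast_sub (Nat.div_le_div_right hAB)]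
  have h3 : (Nat.totient k : ℝ) / k = ∑ e ∈ k.divisors, (μ e : ℝ) / e :=
    (SquarefreeSums.sum_divisors_moebius_div k hk).symm
  rw [h1, h3, Finset.sum_mul, ← Finset.sum_sub_distrib]
  calc |∑ e ∈ k.divisors, ((μ e : ℝ) * (#((Ioc A B).filter (fun m : ℕ => e ∣ m)) : ℝ) - (μ e : ℝ) / e * ((B : ℝ) - A))|
      ≤ ∑ e ∈ k.divisors, |(μ e : ℝ) * (#((Ioc A B).filter (fun m : ℕ => e ∣ m)) : ℝ) - (μ e : ℝ) / e * ((B : ℝ) - A)| :=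
        Finset.abs_sum_le_sum_abs _ _
    _ ≤ ∑ _e ∈ k.divisors, (1 : ℝ) := by
        refine Finset.sum_le_sum fun e he => ?_
        have he0 : 0 < e := Nat.pos_of_mem_divisors he
        rw [h2 e he, show (μ e : ℝ) * (((B / e : ℕ) : ℝ) - ((A / e : ℕ) : ℝ)) - (μ e : ℝ) / e * ((B : ℝ) - A) =
          (μ e : ℝ) * ((((B / e : ℕ) : ℝ) - ((A / e : ℕ) : ℝ)) - ((B : ℝ) - A) / e) by ring, abs_mul]
        have hμ : |(μ e : ℝ)| ≤ 1 := by exact_mod_cast ArithmeticFunction.abs_moebius_le_one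
        exact mul_le_one₀ hμ (abs_nonneg _) (abs_natDiv_sub_natDiv_sub_le he0 A B)
    _ = (σ 0 k : ℝ) := by
        rw [Finset.sum_const, nsmul_eq_mul, mul_one, ArithmeticFunction.sigma_zero_apply]

/-- With a divisibility condition: `|#{m ∈ (⌊u⌋,⌊v⌋] : d ∣ m, (m,k)=1} − (φ(k)/k)(v−u) g_k(d)| ≤ 2τ(k)`
(`g_k(d) = 1_{(d,k)=1}/d`, `Literature.NumberTheory.Sieve.BFI.coprimeRecip`). [folklore] -/
theorem abs_card_dvd_coprime_sub_le {u v : ℝ} (hu : 0 ≤ u) (huv : u ≤ v) {d k : ℕ} (hd : 0 < d) (hk : k ≠ 0) :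
    |(#((Ioc ⌊u⌋₊ ⌊v⌋₊).filter (fun m : ℕ => d ∣ m ∧ m.Coprime k)) : ℝ) -
        (Nat.totient k : ℝ) / k * (v - u) * coprimeRecip k d| ≤ 2 * (σ 0 k : ℝ) := by
  have hv : 0 ≤ v := hu.trans huv
  have hτ1 : (1 : ℝ) ≤ σ 0 k := by exact_mod_cast one_le_sigma_zero hk
  have hd' : (0 : ℝ) < d := by exact_mod_cast hd
  rw [coprimeRecip_apply]
  by_cases hdk : d.Coprime k
  · rw [if_pos hdk]
    -- reduce to the box `(⌊u/d⌋, ⌊v/d⌋]`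
    have hcount : (#((Ioc ⌊u⌋₊ ⌊v⌋₊).filter (fun m : ℕ => d ∣ m ∧ m.Coprime k)) : ℝ) =
        (#((Ioc ⌊u / d⌋₊ ⌊v / d⌋₊).filter (fun m' : ℕ => m'.Coprime k)) : ℝ) := by
      rw [Finset.card_eq_sum_ones, Finset.card_eq_sum_ones, Nat.cast_sum, Nat.cast_sum,
        Finset.sum_filter, Finset.sum_filter]
      push_cast
      have h1 : (∑ m ∈ Ioc ⌊u⌋₊ ⌊v⌋₊, if d ∣ m ∧ m.Coprime k then (1 : ℝ) else 0) =
          ∑ m ∈ (Ioc ⌊u⌋₊ ⌊v⌋₊).filter (fun m : ℕ => d ∣ m), (if m.Coprime k then (1 : ℝ) else 0) := by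
        rw [Finset.sum_filter]
        refine Finset.sum_congr rfl fun m _ => ?_
        by_cases h1 : d ∣ m <;> by_cases h2 : m.Coprime k <;> simp [h1, h2]
      rw [h1, sum_Ioc_filter_dvd_eq_sum_div hu hv hd]
      refine Finset.sum_congr rfl fun m' _ => ?_
      have hiff : (d * m').Coprime k ↔ m'.Coprime k := by
        rw [Nat.coprime_mul_iff_left]; exact ⟨fun h => h.2, fun h => ⟨hdk, h⟩⟩
      by_cases hm : m'.Coprime k
      · rw [if_pos hm, if_pos (hiff.2 hm)]
      · rw [if_neg hm, if_neg (fun h => hm (hiff.1 h))]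
    rw [hcount]
    have hAB : ⌊u / d⌋₊ ≤ ⌊v / d⌋₊ := Nat.floor_le_floor (div_le_div_of_nonneg_right huv hd'.le)
    have h2 := abs_card_coprime_sub_le hk ⌊u / d⌋₊ ⌊v / d⌋₊ hAB
    -- the floors
    have hfl : |((⌊v / d⌋₊ : ℝ) - ⌊u / d⌋₊) - (v - u) / d| ≤ 1 := by
      have a1 : (⌊v / d⌋₊ : ℝ) ≤ v / d := Nat.floor_le (by positivity)
      have a2 : v / d < (⌊v / d⌋₊ : ℝ) + 1 := Nat.lt_floor_add_one _
      have b1 : (⌊u / d⌋₊ : ℝ) ≤ u / d := Nat.floor_le (by positivity)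
      have b2 : u / d < (⌊u / d⌋₊ : ℝ) + 1 := Nat.lt_floor_add_one _
      rw [sub_div, abs_le]; constructor <;> linarith
    have hφ : 0 ≤ (Nat.totient k : ℝ) / k ∧ (Nat.totient k : ℝ) / k ≤ 1 := by
      have hk0 : (0 : ℝ) < k := by exact_mod_cast Nat.pos_of_ne_zero hk
      refine ⟨by positivity, ?_⟩
      rw [div_le_one hk0]; exact_mod_cast Nat.totient_le k
    have h3 : |(Nat.totient k : ℝ) / k * ((⌊v / d⌋₊ : ℝ) - ⌊u / d⌋₊) -
        (Nat.totient k : ℝ) / k * (v - u) * ((d : ℝ))⁻¹| ≤ 1 := by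
      rw [show (Nat.totient k : ℝ) / k * ((⌊v / d⌋₊ : ℝ) - ⌊u / d⌋₊) -
          (Nat.totient k : ℝ) / k * (v - u) * ((d : ℝ))⁻¹ =
          (Nat.totient k : ℝ) / k * (((⌊v / d⌋₊ : ℝ) - ⌊u / d⌋₊) - (v - u) / d) by ring, abs_mul,
        abs_of_nonneg hφ.1]
      exact mul_le_one₀ hφ.2 (abs_nonneg _) hfl
    calc |(#((Ioc ⌊u / d⌋₊ ⌊v / d⌋₊).filter (fun m' : ℕ => m'.Coprime k)) : ℝ) -
          (Nat.totient k : ℝ) / k * (v - u) * ((d : ℝ))⁻¹|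
        ≤ |(#((Ioc ⌊u / d⌋₊ ⌊v / d⌋₊).filter (fun m' : ℕ => m'.Coprime k)) : ℝ) -
            (Nat.totient k : ℝ) / k * ((⌊v / d⌋₊ : ℝ) - ⌊u / d⌋₊)| +
          |(Nat.totient k : ℝ) / k * ((⌊v / d⌋₊ : ℝ) - ⌊u / d⌋₊) -
            (Nat.totient k : ℝ) / k * (v - u) * ((d : ℝ))⁻¹| := abs_sub_le _ _ _
      _ ≤ (σ 0 k : ℝ) + 1 := add_le_add h2 h3
      _ ≤ 2 * (σ 0 k : ℝ) := by linarith
  · rw [if_neg hdk, mul_zero, sub_zero]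
    have hempty : (Ioc ⌊u⌋₊ ⌊v⌋₊).filter (fun m : ℕ => d ∣ m ∧ m.Coprime k) = ∅ := by
      rw [Finset.filter_eq_empty_iff]
      rintro m - ⟨hdm, hmk⟩
      exact hdk (Nat.Coprime.coprime_dvd_left hdm hmk)
    rw [hempty, Finset.card_empty, Nat.cast_zero, abs_zero]
    positivity

/-- Exchanging the sums: a weighted divisor-sum function summed against a coprimality condition. [folklore] -/
theorem sum_weightFn_mul_indicator (w : ℕ × Finset ℕ → ℝ) (J : Finset (ℕ × Finset ℕ)) (I : Finset ℕ) (k : ℕ) :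
    ∑ m ∈ I, (∑ i ∈ J, w i * (if TwoRangeSieve.modOf i ∣ m then (1 : ℝ) else 0)) *
        (if m.Coprime k then (1 : ℝ) else 0) =
      ∑ i ∈ J, w i * (#(I.filter (fun m : ℕ => TwoRangeSieve.modOf i ∣ m ∧ m.Coprime k)) : ℝ) := by
  calc ∑ m ∈ I, (∑ i ∈ J, w i * (if TwoRangeSieve.modOf i ∣ m then (1 : ℝ) else 0)) *
        (if m.Coprime k then (1 : ℝ) else 0)
      = ∑ m ∈ I, ∑ i ∈ J, w i * (if TwoRangeSieve.modOf i ∣ m ∧ m.Coprime k then (1 : ℝ) else 0) := by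
        refine Finset.sum_congr rfl fun m _ => ?_
        rw [Finset.sum_mul]
        refine Finset.sum_congr rfl fun i _ => ?_
        by_cases h1 : TwoRangeSieve.modOf i ∣ m <;> by_cases h2 : m.Coprime k <;> simp [h1, h2]
    _ = ∑ i ∈ J, ∑ m ∈ I, w i * (if TwoRangeSieve.modOf i ∣ m ∧ m.Coprime k then (1 : ℝ) else 0) :=
        Finset.sum_comm
    _ = _ := by
        refine Finset.sum_congr rfl fun i _ => ?_
        rw [← Finset.mul_sum, ← Finset.sum_filter, Finset.card_eq_sum_ones, Nat.cast_sum]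
        simp

/-- **The expected-term discrepancy of the composite sieve in a box**, for the density
`g_k(d) = 1_{(d,k)=1}/d` of the integers coprime to `k`:
`∑_{m ∈ box, (m,k)=1} (U(m) − L(m)) ≤ (φ(k)/k)(v−u)·2(η₁ + (2+2η₁)T_λ) + 4τ(k)·N_w`, where
`T_λ = λ^{−(2r+1)} (e⁵ log z/log z₁)^{λ}` (any `λ > 0`) bounds the Bonferroni tail uniformly in `k`,
and `N_w = 2(D₁+1)(#𝒫₂+1)^{2r+1}` the support. [folklore] -/
theorem sum_UL_coprime_le {z₁ z D₁ u v lam : ℝ} {r : ℕ} (hz₁ : 2 ≤ z₁) (hz : z₁ ≤ z) (hD1 : 1 < D₁)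
    (hzD : 10 * Real.log z₁ ≤ Real.log D₁) (hu : 0 ≤ u) (huv : u ≤ v) (hlam : 0 < lam) {k : ℕ} (hk : k ≠ 0) :
    ∑ m ∈ Ioc ⌊u⌋₊ ⌊v⌋₊, (∑ i ∈ TwoRangeSieve.idx z₁ z,
        (TwoRangeSieve.wU D₁ r i - TwoRangeSieve.wL D₁ r i) *
          (if TwoRangeSieve.modOf i ∣ m then (1 : ℝ) else 0)) * (if m.Coprime k then (1 : ℝ) else 0) ≤
      (Nat.totient k : ℝ) / k * (v - u) *
          (2 * (2 * Real.exp 5 ^ 10 * Real.exp (10 - Real.log D₁ / Real.log z₁) +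
            (2 + 2 * (2 * Real.exp 5 ^ 10 * Real.exp (10 - Real.log D₁ / Real.log z₁))) *
              ((lam ^ (2 * r + 1))⁻¹ * Real.exp (lam * Real.log (Real.exp 5 * (Real.log z / Real.log z₁)))))) +
        4 * (σ 0 k : ℝ) * (2 * (D₁ + 1) * ((TwoRangeSieve.midPrimes z₁ z).card + 1 : ℝ) ^ (2 * r + 1)) := by
  set J := TwoRangeSieve.idx z₁ z with hJ
  set w : ℕ × Finset ℕ → ℝ := fun i => TwoRangeSieve.wU D₁ r i - TwoRangeSieve.wL D₁ r i with hw
  set g := coprimeRecip k with hg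
  set η₁ : ℝ := 2 * Real.exp 5 ^ 10 * Real.exp (10 - Real.log D₁ / Real.log z₁) with hη₁
  set T₀ : ℝ := (lam ^ (2 * r + 1))⁻¹ * Real.exp (lam * Real.log (Real.exp 5 * (Real.log z / Real.log z₁))) with hT₀
  set Nw : ℝ := 2 * (D₁ + 1) * ((TwoRangeSieve.midPrimes z₁ z).card + 1 : ℝ) ^ (2 * r + 1) with hNw
  have hφk : 0 ≤ (Nat.totient k : ℝ) / k := by positivity
  rw [sum_weightFn_mul_indicator w J _ k]
  -- compare each count with the density
  have hmain : |∑ i ∈ J, w i * (#((Ioc ⌊u⌋₊ ⌊v⌋₊).filter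
      (fun m : ℕ => TwoRangeSieve.modOf i ∣ m ∧ m.Coprime k)) : ℝ) -
      (Nat.totient k : ℝ) / k * (v - u) * ∑ i ∈ J, w i * g (TwoRangeSieve.modOf i)| ≤
      2 * (σ 0 k : ℝ) * ∑ i ∈ J, |w i| := by
    rw [Finset.mul_sum, ← Finset.sum_sub_distrib, Finset.mul_sum]
    refine (Finset.abs_sum_le_sum_abs _ _).trans (Finset.sum_le_sum fun i hi => ?_)
    have hd0 : 0 < TwoRangeSieve.modOf i := by
      rw [hJ, TwoRangeSieve.idx, Finset.mem_product, Nat.mem_divisors, Finset.mem_powerset] at hi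
      unfold TwoRangeSieve.modOf
      refine Nat.mul_pos (Nat.pos_of_ne_zero fun h0 => ?_) (Finset.prod_pos fun p hp =>
        (TwoRangeSieve.prime_of_mem_midPrimes (hi.2 hp)).pos)
      rw [h0] at hi; exact primesProdBelow_ne_zero z₁ (zero_dvd_iff.1 hi.1.1)
    have h := abs_card_dvd_coprime_sub_le hu huv hd0 hk
    rw [show w i * (#((Ioc ⌊u⌋₊ ⌊v⌋₊).filter (fun m : ℕ => TwoRangeSieve.modOf i ∣ m ∧ m.Coprime k)) : ℝ) -
        (Nat.totient k : ℝ) / k * (v - u) * (w i * g (TwoRangeSieve.modOf i)) =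
        w i * ((#((Ioc ⌊u⌋₊ ⌊v⌋₊).filter (fun m : ℕ => TwoRangeSieve.modOf i ∣ m ∧ m.Coprime k)) : ℝ) -
          (Nat.totient k : ℝ) / k * (v - u) * g (TwoRangeSieve.modOf i)) by ring, abs_mul]
    rw [mul_comm (2 * (σ 0 k : ℝ)) |w i|]
    exact mul_le_mul_of_nonneg_left h (abs_nonneg _)
  -- the main terms of the composite weights for `g = g_k`
  have hgm := isMultiplicative_coprimeRecip k
  have hdim := hasSieveDimension_coprimeRecip k
  obtain ⟨hU, hL⟩ := TwoRangeSieve.abs_main_sub_le (r := r) hgm hdim z hz₁ hD1 hzD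
  obtain ⟨hV₂pos, -, hTb⟩ := TwoRangeSieve.vmid_tail_bounds (r := r) hdim hz₁ hz
  have hT := hTb lam hlam
  set V₁ := BetaSieve.vprod g (primesProdBelow z₁) with hV₁
  set V₂ := TwoRangeSieve.vmid g z₁ z with hV₂
  set T := TwoRangeSieve.tail g z₁ z r with hTdef
  have h01 : ∀ p : ℕ, p.Prime → 0 ≤ g p ∧ g p ≤ 1 := fun p hp => ⟨(hdim.1 p hp).1, (hdim.1 p hp).2.le⟩
  have hV₁le : V₁ ≤ 1 := by
    rw [hV₁]; unfold BetaSieve.vprod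
    exact Finset.prod_le_one (fun p hp => by linarith [(h01 p (Nat.prime_of_mem_primeFactors hp)).2])
      fun p hp => by linarith [(h01 p (Nat.prime_of_mem_primeFactors hp)).1]
  have hV₁0 : 0 ≤ V₁ := BetaSieve.vprod_nonneg fun p hp => h01 p (Nat.prime_of_mem_primeFactors hp)
  have hV₂le : V₂ ≤ 1 := by
    rw [hV₂]; unfold TwoRangeSieve.vmid
    exact Finset.prod_le_one (fun p hp => by linarith [(h01 p (TwoRangeSieve.prime_of_mem_midPrimes hp)).2])
      fun p hp => by linarith [(h01 p (TwoRangeSieve.prime_of_mem_midPrimes hp)).1]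
  have hT0 : 0 ≤ T := Finset.sum_nonneg fun S hS => Finset.prod_nonneg fun p hp =>
    (h01 p (TwoRangeSieve.prime_of_mem_midPrimes ((Finset.mem_powersetCard.1 hS).1 hp))).1
  have hη₁0 : 0 ≤ η₁ := by positivity
  have hdiff : ∑ i ∈ J, w i * g (TwoRangeSieve.modOf i) ≤ 2 * (η₁ + (2 + 2 * η₁) * T₀) := by
    have e : ∑ i ∈ J, w i * g (TwoRangeSieve.modOf i) =
        (∑ i ∈ J, TwoRangeSieve.wU D₁ r i * g (TwoRangeSieve.modOf i)) -
          ∑ i ∈ J, TwoRangeSieve.wL D₁ r i * g (TwoRangeSieve.modOf i) := by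
      rw [← Finset.sum_sub_distrib]; exact Finset.sum_congr rfl fun i _ => by rw [hw]; ring
    rw [e]
    have h1 := (abs_le.1 hU).2
    have h2 := (abs_le.1 hL).1
    have hbound : V₁ * (η₁ * V₂ + (2 + 2 * η₁) * T) ≤ η₁ + (2 + 2 * η₁) * T₀ := by
      calc V₁ * (η₁ * V₂ + (2 + 2 * η₁) * T) ≤ 1 * (η₁ * 1 + (2 + 2 * η₁) * T₀) := by
            refine mul_le_mul hV₁le (add_le_add (mul_le_mul_of_nonneg_left hV₂le hη₁0)
              (mul_le_mul_of_nonneg_left hT (by positivity))) (by positivity) zero_le_one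
        _ = _ := by ring
    linarith
  have habs : ∑ i ∈ J, |w i| ≤ Nw := by
    refine le_trans (Finset.sum_le_sum fun i _ => ?_) (TwoRangeSieve.sum_abs_w_le (z := z) (r := r) hD1 hzD)
    rw [hw]; exact abs_sub _ _
  have hτ0 : 0 ≤ (σ 0 k : ℝ) := Nat.cast_nonneg _
  have key := (abs_le.1 hmain).2
  calc ∑ i ∈ J, w i * (#((Ioc ⌊u⌋₊ ⌊v⌋₊).filter (fun m : ℕ => TwoRangeSieve.modOf i ∣ m ∧ m.Coprime k)) : ℝ)
      ≤ (Nat.totient k : ℝ) / k * (v - u) * ∑ i ∈ J, w i * g (TwoRangeSieve.modOf i) +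
          2 * (σ 0 k : ℝ) * ∑ i ∈ J, |w i| := by linarith
    _ ≤ (Nat.totient k : ℝ) / k * (v - u) * (2 * (η₁ + (2 + 2 * η₁) * T₀)) + 2 * (σ 0 k : ℝ) * Nw :=
        add_le_add (mul_le_mul_of_nonneg_left hdiff (mul_nonneg hφk (by linarith)))
          (mul_le_mul_of_nonneg_left habs (by positivity))
    _ ≤ _ := by rw [hη₁, hT₀, hNw]; nlinarith [hτ0, mul_nonneg hτ0 (show (0:ℝ) ≤ 2 * (D₁ + 1) *
          ((TwoRangeSieve.midPrimes z₁ z).card + 1 : ℝ) ^ (2 * r + 1) by positivity)]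

/-! ### The bilinear pieces `𝒟_d` -/

/-- **`E_d` by Theorem 5 on boxes** (BFI p. 238: "Theorem 5 is applicable to `E_d` giving
`E_d ≪ ‖β‖ x^{1/2−ε} M^{1/2}`"): if the boxed Theorem 5 bound holds at `x` with `ε/2` (for the fixed
`Q, R, γ, δ`), then for `MN = x` under (A₁), (12.5) and every `1 ≤ d ≤ x^{ε/2}`, box
`(u, v] ⊆ [M, 2M]`:
`|∑_{u<m≤v, d∣m} F(m)| ≤ C₅ ‖β‖ x^{1/2−ε''} M^{1/2}` (the sum is `𝒟` at the scale `(M/d, dN)` with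
coefficients `1_{(u/d, v/d]}` and `β' = betaMul d β`, `‖β'‖ = ‖β‖`).
[cite: BombieriFriedlanderIwaniecActa1986, §12 p. 238] -/
theorem abs_sum_filter_dvd_rowF_le {a : ℤ} {x ε εs C₅ M N Q R u v : ℝ} {β γ δ : ℕ → ℝ}
    (h5 : ∀ M' N' : ℝ, M' * N' = x → x ^ (ε / 2) ≤ N' → N' ≤ x ^ (1 - ε / 2) →
      x ^ (ε / 2) * thm5Threshold x Q R < M' → ∀ M₁ M₂ : ℝ, ∀ β' : ℕ → ℝ,
      |dispD a M' N' Q R (fun m => if M₁ < (m : ℝ) ∧ (m : ℝ) ≤ M₂ then 1 else 0) β' γ δ| ≤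
        C₅ * Real.sqrt (l2Sq N' β') * x ^ (1 / 2 - εs) * M' ^ (1 / 2 : ℝ))
    (hx : 1 < x) (hε : 0 < ε) (hMN : M * N = x) (hN1 : x ^ ε ≤ N) (hN2 : N ≤ x ^ (1 - ε))
    (hQ : 1 / 2 ≤ Q) (hthr : x ^ ε * thm5Threshold x Q R < M) (hC₅ : 0 ≤ C₅) (hMu : M ≤ u)
    (huv : u ≤ v) (hv : v ≤ 2 * M) {d : ℕ} (hd : 0 < d) (hdx : (d : ℝ) ≤ x ^ (ε / 2)) :
    |∑ m ∈ (Ioc ⌊u⌋₊ ⌊v⌋₊).filter (fun m : ℕ => d ∣ m), rowF a N Q R β γ δ m| ≤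
      C₅ * Real.sqrt (l2Sq N β) * x ^ (1 / 2 - εs) * M ^ (1 / 2 : ℝ) := by
  have hx0 : 0 < x := by linarith
  have hxε : 0 < x ^ ε := Real.rpow_pos_of_pos hx0 ε
  have hN0 : 0 < N := hxε.trans_le hN1
  have hTQ : Q ≤ thm5Threshold x Q R := le_trans (le_max_left _ _) (le_max_left _ _)
  have hT0 : 0 ≤ thm5Threshold x Q R := le_trans (by linarith) hTQ
  have hM0 : 0 < M := lt_of_le_of_lt (mul_nonneg hxε.le hT0) hthr
  have hu0 : 0 ≤ u := hM0.le.trans hMu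
  have hv0 : 0 ≤ v := hu0.trans huv
  have hd' : (0 : ℝ) < d := by exact_mod_cast hd
  have hd1 : (1 : ℝ) ≤ d := by exact_mod_cast hd
  have hMd : 0 ≤ M / d := by positivity
  rw [sum_Ioc_filter_dvd_eq_sum_div hu0 hv0 hd]
  simp_rw [rowF_mul_left a hN0.le Q R β γ δ hd]
  have e : ∑ m' ∈ Ioc ⌊u / d⌋₊ ⌊v / d⌋₊, rowF a ((d : ℝ) * N) Q R (betaMul d β) γ δ m' =
      dispD a (M / d) ((d : ℝ) * N) Q R
        (fun m' => if u / d < (m' : ℝ) ∧ (m' : ℝ) ≤ v / d then 1 else 0) (betaMul d β) γ δ := by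
    have hone : (fun m' : ℕ => if u / d < (m' : ℝ) ∧ (m' : ℝ) ≤ v / d then (1 : ℝ) else 0) =
        fun m' : ℕ => if u / d < (m' : ℝ) ∧ (m' : ℝ) ≤ v / d then roughIndicator 0 m' else 0 := by
      funext m'; rw [roughIndicator_of_le_two (by norm_num)]
    rw [hone, dispD_box_eq_boxSum a hMd (div_le_div_of_nonneg_right hMu hd'.le)
      (div_le_div_of_nonneg_right huv hd'.le) (by rw [mul_div_assoc']; exact div_le_div_of_nonneg_right hv hd'.le)]
    unfold boxSum
    refine Finset.sum_congr rfl fun m' _ => ?_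
    show _ = roughIndicator 0 m' * _
    rw [roughIndicator_of_le_two (by norm_num), one_mul]
  rw [e]
  have hMN' : M / d * ((d : ℝ) * N) = x := by rw [← hMN]; field_simp
  have hN1' : x ^ (ε / 2) ≤ (d : ℝ) * N :=
    (Real.rpow_le_rpow_of_exponent_le hx.le (by linarith)).trans (hN1.trans (le_mul_of_one_le_left hN0.le hd1))
  have hN2' : (d : ℝ) * N ≤ x ^ (1 - ε / 2) := by
    calc (d : ℝ) * N ≤ x ^ (ε / 2) * x ^ (1 - ε) := mul_le_mul hdx hN2 hN0.le (by positivity)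
      _ = x ^ (1 - ε / 2) := by rw [← Real.rpow_add hx0]; ring_nf
  have hthr' : x ^ (ε / 2) * thm5Threshold x Q R < M / d := by
    rw [lt_div_iff₀ hd']
    calc x ^ (ε / 2) * thm5Threshold x Q R * d ≤ x ^ (ε / 2) * thm5Threshold x Q R * x ^ (ε / 2) :=
          mul_le_mul_of_nonneg_left hdx (by positivity)
      _ = x ^ ε * thm5Threshold x Q R := by
          rw [show x ^ ε = x ^ (ε / 2) * x ^ (ε / 2) by rw [← Real.rpow_add hx0]; ring_nf]; ring
      _ < M := hthr
  refine (h5 (M / d) ((d : ℝ) * N) hMN' hN1' hN2' hthr' (u / d) (v / d) (betaMul d β)).trans ?_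
  rw [l2Sq_betaMul hN0.le hd]
  refine mul_le_mul_of_nonneg_left (Real.rpow_le_rpow hMd (div_le_self hM0.le hd1) (by norm_num)) ?_
  positivity

/-! ### The expected-term remainder -/

/-- **The remainder `Δ` of BFI p. 238, summed over the moduli**: for nonnegative `β, γ, δ` with
`γ ≤ τ^B`, `δ ≤ τ^B`, the composite sieve functions `U ≥ L` of
`Literature.NumberTheory.Sieve.TwoRangeSieve` and a box `(u, v]` of length `≤ M`,
`∑_{u<m≤v} (U(m) − L(m)) F_B(m) ≤ ‖β‖₁ (M E + 4 N_w) ∑_{q∼Q,r∼R} τ(q)^{B+1}τ(r)^{B+1}/φ(qr)`, where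
`E = 2(η₁ + (2+2η₁)T_λ)` bounds the sieve main-term discrepancy for every `g_{qr}` and `N_w` the support
size (`sum_UL_coprime_le`). [cite: BombieriFriedlanderIwaniecActa1986, §12 p. 238] -/
theorem sum_UL_rowB_le {a : ℤ} {z₁ z D₁ u v lam M N Q R : ℝ} {r B : ℕ} {β γ δ : ℕ → ℝ}
    (hz₁ : 2 ≤ z₁) (hz : z₁ ≤ z) (hD1 : 1 < D₁) (hzD : 10 * Real.log z₁ ≤ Real.log D₁)
    (hu : 0 ≤ u) (huv : u ≤ v) (hvu : v - u ≤ M) (hlam : 0 < lam) (hQ : 0 ≤ Q) (hR : 0 ≤ R)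
    (hβ : ∀ n, 0 ≤ β n) (hγ : ∀ q, 0 ≤ γ q) (hδ : ∀ r, 0 ≤ δ r)
    (hγB : ∀ q, γ q ≤ (σ 0 q : ℝ) ^ B) (hδB : ∀ r, δ r ≤ (σ 0 r : ℝ) ^ B) :
    ∑ m ∈ Ioc ⌊u⌋₊ ⌊v⌋₊, (∑ i ∈ TwoRangeSieve.idx z₁ z,
        (TwoRangeSieve.wU D₁ r i - TwoRangeSieve.wL D₁ r i) *
          (if TwoRangeSieve.modOf i ∣ m then (1 : ℝ) else 0)) * rowB a N Q R β γ δ m ≤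
      (∑ n ∈ dyadic N, β n) *
        (M * (2 * (2 * Real.exp 5 ^ 10 * Real.exp (10 - Real.log D₁ / Real.log z₁) +
            (2 + 2 * (2 * Real.exp 5 ^ 10 * Real.exp (10 - Real.log D₁ / Real.log z₁))) *
              ((lam ^ (2 * r + 1))⁻¹ * Real.exp (lam * Real.log (Real.exp 5 * (Real.log z / Real.log z₁)))))) +
          4 * (2 * (D₁ + 1) * ((TwoRangeSieve.midPrimes z₁ z).card + 1 : ℝ) ^ (2 * r + 1))) *
        ∑ q ∈ dyadic Q, ∑ r' ∈ dyadic R,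
          (σ 0 q : ℝ) ^ (B + 1) * (σ 0 r' : ℝ) ^ (B + 1) / (Nat.totient (q * r') : ℝ) := by
  set E : ℝ := 2 * (2 * Real.exp 5 ^ 10 * Real.exp (10 - Real.log D₁ / Real.log z₁) +
      (2 + 2 * (2 * Real.exp 5 ^ 10 * Real.exp (10 - Real.log D₁ / Real.log z₁))) *
        ((lam ^ (2 * r + 1))⁻¹ * Real.exp (lam * Real.log (Real.exp 5 * (Real.log z / Real.log z₁))))) with hE
  set Nw : ℝ := 2 * (D₁ + 1) * ((TwoRangeSieve.midPrimes z₁ z).card + 1 : ℝ) ^ (2 * r + 1) with hNw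
  obtain ⟨W, hW⟩ : ∃ W : ℕ → ℝ, ∀ m, W m = ∑ i ∈ TwoRangeSieve.idx z₁ z,
      (TwoRangeSieve.wU D₁ r i - TwoRangeSieve.wL D₁ r i) *
        (if TwoRangeSieve.modOf i ∣ m then (1 : ℝ) else 0) := ⟨_, fun m => rfl⟩
  simp_rw [← hW]
  have hM0 : 0 ≤ M := le_trans (by linarith) hvu
  set b₁ : ℝ := ∑ n ∈ dyadic N, β n with hb₁
  have hb₁0 : 0 ≤ b₁ := Finset.sum_nonneg fun n _ => hβ n
  have hE0 : 0 ≤ E := by positivity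
  have hNw0 : 0 ≤ Nw := by positivity
  -- `W(m) = U(m) − L(m) ≥ 0` on `m ≥ 1`
  have hW0 : ∀ m ∈ Ioc ⌊u⌋₊ ⌊v⌋₊, 0 ≤ W m := by
    intro m hm
    rw [Finset.mem_Ioc] at hm
    have hm0 : m ≠ 0 := by omega
    obtain ⟨h1, h2⟩ := TwoRangeSieve.sandwich hz D₁ r hm0
    have e : W m =
        (∑ i ∈ TwoRangeSieve.idx z₁ z, TwoRangeSieve.wU D₁ r i * (if TwoRangeSieve.modOf i ∣ m then (1 : ℝ) else 0)) -
        ∑ i ∈ TwoRangeSieve.idx z₁ z, TwoRangeSieve.wL D₁ r i * (if TwoRangeSieve.modOf i ∣ m then (1 : ℝ) else 0) := by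
      rw [hW, ← Finset.sum_sub_distrib]; exact Finset.sum_congr rfl fun i _ => by ring
    rw [e]; linarith
  -- Step 1: `F_B(m) ≤ b₁ ∑_{q,r} γδ 1_{(m,qr)=1}/φ(qr)`
  have step1 : ∑ m ∈ Ioc ⌊u⌋₊ ⌊v⌋₊, W m * rowB a N Q R β γ δ m ≤
      ∑ m ∈ Ioc ⌊u⌋₊ ⌊v⌋₊, W m * (b₁ * ∑ q ∈ dyadic Q, ∑ r' ∈ dyadic R,
        γ q * δ r' * (if m.Coprime (q * r') then 1 else 0) / (Nat.totient (q * r') : ℝ)) :=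
    Finset.sum_le_sum fun m hm => mul_le_mul_of_nonneg_left (rowB_nonneg_le a N Q R hβ hγ hδ m).2 (hW0 m hm)
  refine step1.trans ?_
  -- Step 2: exchange the sums
  have step2 : ∑ m ∈ Ioc ⌊u⌋₊ ⌊v⌋₊, W m * (b₁ * ∑ q ∈ dyadic Q, ∑ r' ∈ dyadic R,
        γ q * δ r' * (if m.Coprime (q * r') then 1 else 0) / (Nat.totient (q * r') : ℝ)) =
      b₁ * ∑ q ∈ dyadic Q, ∑ r' ∈ dyadic R, (γ q * δ r' / (Nat.totient (q * r') : ℝ)) *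
        ∑ m ∈ Ioc ⌊u⌋₊ ⌊v⌋₊, W m * (if m.Coprime (q * r') then 1 else 0) := by
    rw [Finset.mul_sum]
    simp_rw [Finset.mul_sum]
    rw [Finset.sum_comm]
    refine Finset.sum_congr rfl fun q _ => ?_
    rw [Finset.sum_comm]
    refine Finset.sum_congr rfl fun r' _ => ?_
    exact Finset.sum_congr rfl fun m _ => by ring
  rw [step2]
  -- Step 3: the inner sums by `sum_UL_coprime_le`
  have step3 : ∀ q ∈ dyadic Q, ∀ r' ∈ dyadic R,
      (γ q * δ r' / (Nat.totient (q * r') : ℝ)) * ∑ m ∈ Ioc ⌊u⌋₊ ⌊v⌋₊, W m * (if m.Coprime (q * r') then 1 else 0) ≤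
        (M * E + 4 * Nw) * ((σ 0 q : ℝ) ^ (B + 1) * (σ 0 r' : ℝ) ^ (B + 1) / (Nat.totient (q * r') : ℝ)) := by
    intro q hq r' hr'
    have hq1 := pos_of_mem_dyadic hQ hq
    have hr1 := pos_of_mem_dyadic hR hr'
    have hk : q * r' ≠ 0 := Nat.mul_ne_zero (by omega) (by omega)
    have hk0 : (0 : ℝ) < ((q * r' : ℕ) : ℝ) := by exact_mod_cast Nat.pos_of_ne_zero hk
    have hφpos : (0 : ℝ) < (Nat.totient (q * r') : ℝ) := by exact_mod_cast Nat.totient_pos.2 (Nat.pos_of_ne_zero hk)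
    have hin := sum_UL_coprime_le (r := r) hz₁ hz hD1 hzD hu huv hlam hk
    simp_rw [← hW] at hin
    have hγδ : 0 ≤ γ q * δ r' := mul_nonneg (hγ q) (hδ r')
    have hcoef : 0 ≤ γ q * δ r' / (Nat.totient (q * r') : ℝ) := div_nonneg hγδ hφpos.le
    refine (mul_le_mul_of_nonneg_left hin hcoef).trans ?_
    -- `γδ ≤ τ(q)^B τ(r)^B ≤ τ(q)^{B+1}τ(r)^{B+1}`, `φ(k)/k ≤ 1`, `φ(k) ≤ k`, `τ(qr) ≤ τ(q)τ(r)`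
    have hτq : (1 : ℝ) ≤ σ 0 q := by exact_mod_cast one_le_sigma_zero (by omega : q ≠ 0)
    have hτr : (1 : ℝ) ≤ σ 0 r' := by exact_mod_cast one_le_sigma_zero (by omega : r' ≠ 0)
    have hγδ' : γ q * δ r' ≤ (σ 0 q : ℝ) ^ B * (σ 0 r' : ℝ) ^ B := mul_le_mul (hγB q) (hδB r') (hδ r') (by positivity)
    have hpow : (σ 0 q : ℝ) ^ B * (σ 0 r' : ℝ) ^ B ≤ (σ 0 q : ℝ) ^ (B + 1) * (σ 0 r' : ℝ) ^ (B + 1) := by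
      rw [pow_succ, pow_succ]
      exact mul_le_mul (le_mul_of_one_le_right (by positivity) hτq) (le_mul_of_one_le_right (by positivity) hτr)
        (by positivity) (by positivity)
    have hτqr : (σ 0 (q * r') : ℝ) ≤ (σ 0 q : ℝ) * σ 0 r' := by exact_mod_cast sigma_zero_mul_le q r'
    have hφk : (Nat.totient (q * r') : ℝ) / ((q * r' : ℕ) : ℝ) ≤ 1 := by
      rw [div_le_one hk0]; exact_mod_cast Nat.totient_le (q * r')
    -- first part
    have p1 : (γ q * δ r' / (Nat.totient (q * r') : ℝ)) * ((Nat.totient (q * r') : ℝ) / ((q * r' : ℕ) : ℝ) * (v - u) * E) ≤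
        M * E * ((σ 0 q : ℝ) ^ (B + 1) * (σ 0 r' : ℝ) ^ (B + 1) / (Nat.totient (q * r') : ℝ)) := by
      have e1 : (γ q * δ r' / (Nat.totient (q * r') : ℝ)) * ((Nat.totient (q * r') : ℝ) / ((q * r' : ℕ) : ℝ) * (v - u) * E) =
          (γ q * δ r') * ((v - u) * E) / ((q * r' : ℕ) : ℝ) := by
        field_simp
      rw [e1, div_le_iff₀ hk0]
      have hkφ : ((q * r' : ℕ) : ℝ) ≥ (Nat.totient (q * r') : ℝ) := by exact_mod_cast Nat.totient_le (q * r')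
      calc γ q * δ r' * ((v - u) * E) ≤ ((σ 0 q : ℝ) ^ (B + 1) * (σ 0 r' : ℝ) ^ (B + 1)) * (M * E) :=
            mul_le_mul (hγδ'.trans hpow) (mul_le_mul_of_nonneg_right hvu hE0) (by nlinarith) (by positivity)
        _ = M * E * ((σ 0 q : ℝ) ^ (B + 1) * (σ 0 r' : ℝ) ^ (B + 1) / (Nat.totient (q * r') : ℝ)) *
              (Nat.totient (q * r') : ℝ) := by field_simp
        _ ≤ M * E * ((σ 0 q : ℝ) ^ (B + 1) * (σ 0 r' : ℝ) ^ (B + 1) / (Nat.totient (q * r') : ℝ)) *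
              ((q * r' : ℕ) : ℝ) := mul_le_mul_of_nonneg_left hkφ (by positivity)
    -- second part
    have p2 : (γ q * δ r' / (Nat.totient (q * r') : ℝ)) * (4 * (σ 0 (q * r') : ℝ) * Nw) ≤
        4 * Nw * ((σ 0 q : ℝ) ^ (B + 1) * (σ 0 r' : ℝ) ^ (B + 1) / (Nat.totient (q * r') : ℝ)) := by
      rw [show (γ q * δ r' / (Nat.totient (q * r') : ℝ)) * (4 * (σ 0 (q * r') : ℝ) * Nw) =
          4 * Nw * ((γ q * δ r' * (σ 0 (q * r') : ℝ)) / (Nat.totient (q * r') : ℝ)) by ring]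
      refine mul_le_mul_of_nonneg_left (div_le_div_of_nonneg_right ?_ hφpos.le) (by positivity)
      calc γ q * δ r' * (σ 0 (q * r') : ℝ) ≤ ((σ 0 q : ℝ) ^ B * (σ 0 r' : ℝ) ^ B) * ((σ 0 q : ℝ) * σ 0 r') :=
            mul_le_mul hγδ' hτqr (Nat.cast_nonneg _) (by positivity)
        _ = (σ 0 q : ℝ) ^ (B + 1) * (σ 0 r' : ℝ) ^ (B + 1) := by rw [pow_succ, pow_succ]; ring
    calc (γ q * δ r' / (Nat.totient (q * r') : ℝ)) *
          ((Nat.totient (q * r') : ℝ) / ((q * r' : ℕ) : ℝ) * (v - u) * E + 4 * (σ 0 (q * r') : ℝ) * Nw)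
        = (γ q * δ r' / (Nat.totient (q * r') : ℝ)) * ((Nat.totient (q * r') : ℝ) / ((q * r' : ℕ) : ℝ) * (v - u) * E) +
          (γ q * δ r' / (Nat.totient (q * r') : ℝ)) * (4 * (σ 0 (q * r') : ℝ) * Nw) := by ring
      _ ≤ _ := by
          refine (add_le_add p1 p2).trans (le_of_eq ?_)
          ring
  calc b₁ * ∑ q ∈ dyadic Q, ∑ r' ∈ dyadic R, (γ q * δ r' / (Nat.totient (q * r') : ℝ)) *
        ∑ m ∈ Ioc ⌊u⌋₊ ⌊v⌋₊, W m * (if m.Coprime (q * r') then 1 else 0)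
      ≤ b₁ * ∑ q ∈ dyadic Q, ∑ r' ∈ dyadic R,
          (M * E + 4 * Nw) * ((σ 0 q : ℝ) ^ (B + 1) * (σ 0 r' : ℝ) ^ (B + 1) / (Nat.totient (q * r') : ℝ)) :=
        mul_le_mul_of_nonneg_left (Finset.sum_le_sum fun q hq => Finset.sum_le_sum fun r' hr' => step3 q hq r' hr') hb₁0
    _ = _ := by rw [hE, hNw]; simp_rw [← Finset.mul_sum]; ring

/-! ### Small reductions for the assembly -/

/-- `1_{(·,P(z))=1} = 1_{(·,P(max z 2))=1}`: sifting by the primes `< z ≤ 2` is no sifting. [folklore] -/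
theorem roughIndicator_max_two (z : ℝ) (m : ℕ) : roughIndicator (max z 2) m = roughIndicator z m := by
  rcases le_total z 2 with h | h
  · rw [max_eq_right h, roughIndicator_of_le_two le_rfl, roughIndicator_of_le_two h]
  · rw [max_eq_left h]

/-- For `m ≥ 1`: `1_{(m,P(z))=1}` as a coprimality indicator. [folklore] -/
theorem roughIndicator_eq_coprime_ite (z : ℝ) {m : ℕ} (hm : m ≠ 0) :
    roughIndicator z m = if m.Coprime (primesProdBelow z) then 1 else 0 := by
  rw [roughIndicator_eq_ite]
  by_cases h : IsRough z m
  · rw [if_pos h, if_pos ((isRough_iff_coprime_primesProdBelow hm).1 h)]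
  · rw [if_neg h, if_neg (fun h' => h ((isRough_iff_coprime_primesProdBelow hm).2 h'))]

/-- Exchanging a weighted divisor sum with the `m`-sum. [folklore] -/
theorem sum_weightFn_mul_eq (w : ℕ × Finset ℕ → ℝ) (J : Finset (ℕ × Finset ℕ)) (I : Finset ℕ) (f : ℕ → ℝ) :
    ∑ m ∈ I, (∑ i ∈ J, w i * (if TwoRangeSieve.modOf i ∣ m then (1 : ℝ) else 0)) * f m =
      ∑ i ∈ J, w i * ∑ m ∈ I.filter (fun m : ℕ => TwoRangeSieve.modOf i ∣ m), f m := by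
  calc ∑ m ∈ I, (∑ i ∈ J, w i * (if TwoRangeSieve.modOf i ∣ m then (1 : ℝ) else 0)) * f m
      = ∑ m ∈ I, ∑ i ∈ J, w i * (if TwoRangeSieve.modOf i ∣ m then f m else 0) := by
        refine Finset.sum_congr rfl fun m _ => ?_
        rw [Finset.sum_mul]
        exact Finset.sum_congr rfl fun i _ => by split_ifs <;> ring
    _ = ∑ i ∈ J, ∑ m ∈ I, w i * (if TwoRangeSieve.modOf i ∣ m then f m else 0) := Finset.sum_comm
    _ = _ := by
        refine Finset.sum_congr rfl fun i _ => ?_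
        rw [← Finset.mul_sum, Finset.sum_filter]

/-- Bounding the weighted bilinear pieces by the support of the weights: if every piece with a
nonzero weight is `≤ B_d` in absolute value, the weighted sum is `≤ B_d ∑_i |w_i|`. [folklore] -/
theorem abs_sum_weight_pieces_le (w : ℕ × Finset ℕ → ℝ) (J : Finset (ℕ × Finset ℕ)) (X : ℕ × Finset ℕ → ℝ)
    {Bd : ℝ} (h : ∀ i ∈ J, w i ≠ 0 → |X i| ≤ Bd) :
    |∑ i ∈ J, w i * X i| ≤ Bd * ∑ i ∈ J, |w i| := by
  rw [Finset.mul_sum]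
  refine (Finset.abs_sum_le_sum_abs _ _).trans (Finset.sum_le_sum fun i hi => ?_)
  rw [abs_mul]
  by_cases hw : w i = 0
  · rw [hw, abs_zero, zero_mul, mul_zero]
  · rw [mul_comm]; exact mul_le_mul_of_nonneg_right (h i hi hw) (abs_nonneg _)

/-- **The sieve sandwich for signed rows** (the step `E⁻ − Δ ≤ E ≤ E⁺ + Δ` of BFI p. 238, with
`F = F_A − F_B`, `F_A, F_B ≥ 0`): if `L ≤ ρ ≤ U` pointwise on `I`, then
`|∑_I ρ (F_A − F_B)| ≤ |∑_I U (F_A − F_B)| + |∑_I L (F_A − F_B)| + ∑_I (U − L) F_B`.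
[cite: BombieriFriedlanderIwaniecActa1986, §12 p. 238] -/
theorem abs_sum_sandwich_le (I : Finset ℕ) {ρ U Lw FA FB : ℕ → ℝ} (hL : ∀ m ∈ I, Lw m ≤ ρ m)
    (hU : ∀ m ∈ I, ρ m ≤ U m) (hA : ∀ m ∈ I, 0 ≤ FA m) (hB : ∀ m ∈ I, 0 ≤ FB m) :
    |∑ m ∈ I, ρ m * (FA m - FB m)| ≤
      |∑ m ∈ I, U m * (FA m - FB m)| + |∑ m ∈ I, Lw m * (FA m - FB m)| + ∑ m ∈ I, (U m - Lw m) * FB m := by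
  have h1 : ∑ m ∈ I, ρ m * (FA m - FB m) ≤ ∑ m ∈ I, U m * (FA m - FB m) + ∑ m ∈ I, (U m - Lw m) * FB m := by
    rw [← Finset.sum_add_distrib]
    refine Finset.sum_le_sum fun m hm => ?_
    nlinarith [hL m hm, hU m hm, hA m hm, hB m hm]
  have h2 : ∑ m ∈ I, Lw m * (FA m - FB m) - ∑ m ∈ I, (U m - Lw m) * FB m ≤ ∑ m ∈ I, ρ m * (FA m - FB m) := by
    rw [← Finset.sum_sub_distrib]
    refine Finset.sum_le_sum fun m hm => ?_
    nlinarith [hL m hm, hU m hm, hA m hm, hB m hm]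
  have h3 := le_abs_self (∑ m ∈ I, U m * (FA m - FB m))
  have h4 := neg_abs_le (∑ m ∈ I, Lw m * (FA m - FB m))
  have h5 := abs_nonneg (∑ m ∈ I, U m * (FA m - FB m))
  have h6 := abs_nonneg (∑ m ∈ I, Lw m * (FA m - FB m))
  rw [abs_le]; constructor <;> linarith

/-! ### The large-`x` facts of the assembly -/

/-- The large-`x` facts used in the proof of Theorem 5* from Theorem 5 (one existential witness);
`L = log x`, `ℓ = log log x`. [folklore] -/
theorem core_eventually {ε εs A : ℝ} (hε : 0 < ε) (hεs : 0 < εs) (hA : 0 ≤ A) (x₅ c₄ c₅ c₆ c₇ c₉ c₁₀ c₁₁ : ℝ)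
    (hc₉ : 0 ≤ c₉) (hc₁₁ : 0 ≤ c₁₁) (p : ℝ) (hp : 0 ≤ p) :
    ∃ x₀ : ℝ, ∀ x : ℝ, x₀ ≤ x →
      3 ≤ x ∧ Real.exp (Real.exp 1) ≤ x ∧ x₅ ≤ x ∧ c₄ ≤ Real.log x ∧ c₅ ≤ Real.log (Real.log x) ∧
        c₆ ≤ Real.log (Real.log x) ∧ c₇ ≤ Real.log x ∧ (4 : ℝ) ≤ x ^ (εs / 8) ∧
        c₉ * Real.log x ^ A ≤ x ^ (εs / 2) ∧ c₁₀ ≤ Real.log x ∧ c₁₁ * Real.log x ^ p ≤ x ^ (ε / 2) := by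
  have hlog := Real.tendsto_log_atTop
  have hloglog := Real.tendsto_log_atTop.comp Real.tendsto_log_atTop
  obtain ⟨x₉, hx₉⟩ := exists_polylog_le_rpow hc₉ hA (show (0 : ℝ) < εs / 2 by positivity)
  obtain ⟨x₁₁, hx₁₁⟩ := exists_polylog_le_rpow hc₁₁ hp (half_pos hε)
  have h1 : ∀ᶠ x : ℝ in Filter.atTop, 3 ≤ x := Filter.eventually_ge_atTop 3
  have h2 : ∀ᶠ x : ℝ in Filter.atTop, Real.exp (Real.exp 1) ≤ x := Filter.eventually_ge_atTop _
  have h3 : ∀ᶠ x : ℝ in Filter.atTop, x₅ ≤ x := Filter.eventually_ge_atTop _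
  have h4 : ∀ᶠ x : ℝ in Filter.atTop, c₄ ≤ Real.log x := hlog.eventually_ge_atTop _
  have h5 : ∀ᶠ x : ℝ in Filter.atTop, c₅ ≤ Real.log (Real.log x) := hloglog.eventually_ge_atTop _
  have h6 : ∀ᶠ x : ℝ in Filter.atTop, c₆ ≤ Real.log (Real.log x) := hloglog.eventually_ge_atTop _
  have h7 : ∀ᶠ x : ℝ in Filter.atTop, c₇ ≤ Real.log x := hlog.eventually_ge_atTop _
  have h8 : ∀ᶠ x : ℝ in Filter.atTop, (4 : ℝ) ≤ x ^ (εs / 8) :=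
    (tendsto_rpow_atTop (by positivity)).eventually_ge_atTop _
  have h9 : ∀ᶠ x : ℝ in Filter.atTop, c₉ * Real.log x ^ A ≤ x ^ (εs / 2) := by
    filter_upwards [Filter.eventually_ge_atTop x₉, Filter.eventually_ge_atTop 1] with x hx hx1
    have hL : 0 ≤ Real.log x := Real.log_nonneg hx1
    exact le_trans (mul_le_mul_of_nonneg_left (Real.rpow_le_rpow hL (by linarith) hA) hc₉) (hx₉ x hx)
  have h10 : ∀ᶠ x : ℝ in Filter.atTop, c₁₀ ≤ Real.log x := hlog.eventually_ge_atTop _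
  have h11 : ∀ᶠ x : ℝ in Filter.atTop, c₁₁ * Real.log x ^ p ≤ x ^ (ε / 2) := by
    filter_upwards [Filter.eventually_ge_atTop x₁₁, Filter.eventually_ge_atTop 1] with x hx hx1
    have hL : 0 ≤ Real.log x := Real.log_nonneg hx1
    exact le_trans (mul_le_mul_of_nonneg_left (Real.rpow_le_rpow hL (by linarith) hp) hc₁₁) (hx₁₁ x hx)
  obtain ⟨x₀, hx₀⟩ := Filter.eventually_atTop.1 ((h1.and (h2.and h3)).and ((h4.and (h5.and h6)).and
    ((h7.and h8).and (h9.and (h10.and h11)))))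
  refine ⟨x₀, fun x hx => ?_⟩
  obtain ⟨⟨a1, a2, a3⟩, ⟨a4, a5, a6⟩, ⟨a7, a8⟩, a9, a10, a11⟩ := hx₀ x hx
  exact ⟨a1, a2, a3, a4, a5, a6, a7, a8, a9, a10, a11⟩

/-- The Brun tail numerics: if `k ≥ e Λ e^{16A'/ε}` and `k ≥ (ε/16) ℓ`, then `(eΛ/k)^k ≤ e^{−A'ℓ}`
(`Λ ≥ 1`). [folklore] -/
theorem tail_pow_le {k : ℕ} {Λl A' εs ell : ℝ} (hΛ : 1 ≤ Λl) (hεs : 0 < εs) (hA' : 0 ≤ A')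
    (hk1 : Real.exp 1 * Λl * Real.exp (16 * A' / εs) ≤ k) (hk2 : εs / 16 * ell ≤ k) :
    (Real.exp 1 * Λl / k) ^ k ≤ Real.exp (-(A' * ell)) := by
  have he : 0 < Real.exp 1 * Λl := by positivity
  have hk0 : (0 : ℝ) < k := lt_of_lt_of_le (by positivity) hk1
  have hratio : Real.exp (16 * A' / εs) ≤ k / (Real.exp 1 * Λl) := by
    rw [le_div_iff₀ he]; linarith
  have hlog : 16 * A' / εs ≤ Real.log (k / (Real.exp 1 * Λl)) := by
    rw [Real.le_log_iff_exp_le (by positivity)]; exact hratio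
  have hbase : 0 < Real.exp 1 * Λl / k := by positivity
  rw [← Real.exp_log (pow_pos hbase k), Real.log_pow, Real.exp_le_exp]
  have hlk : Real.log (Real.exp 1 * Λl / k) = -Real.log (k / (Real.exp 1 * Λl)) := by
    rw [← Real.log_inv, inv_div]
  rw [hlk]
  have h1 : (k : ℝ) * Real.log (k / (Real.exp 1 * Λl)) ≥ εs / 16 * ell * (16 * A' / εs) :=
    mul_le_mul hk2 hlog (by positivity) hk0.le
  have h2 : εs / 16 * ell * (16 * A' / εs) = A' * ell := by field_simp
  nlinarith

/-! ### The parameters of the composite sieve -/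

/-- **Choice of the sieve parameters.**  With `L = log x`, `ℓ = log L`, for `x` large in terms of
`ε_s, A'` and a sifting range `2 ≤ z' ≤ exp(L/ℓ)`: the split point `z₁ = min(z', exp(ε_s L/(80A'ℓ)))`,
the level `D₁ = x^{ε_s/8}` and the Brun depth `2r+1 ∈ [(ε_s/8)ℓ − 2, (ε_s/8)ℓ]` satisfy the hypotheses
of the two-range weights, `z'^{2r+1} ≤ x^{ε_s/8}`, and make the main-term discrepancy
`E = 2(η₁ + (2+2η₁)T_λ)` (with `λ = (2r+1)/log Λ'`, `Λ' = e⁵·80A'/ε_s`) at most `10 L^{−A'}`. [folklore] -/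
theorem core_params {εs A' x z' : ℝ} (hεs : 0 < εs) (hεs4 : εs ≤ 1 / 4) (hA'1 : 1 ≤ A')
    (hxee : Real.exp (Real.exp 1) ≤ x)
    (hc4 : (80 * A' / εs) ^ 2 ≤ Real.log x) (hc5 : 16 / εs ≤ Real.log (Real.log x))
    (hc6 : 16 / εs * (Real.exp 1 * Real.log (Real.exp 5 * (80 * A' / εs)) * Real.exp (16 * A' / εs) + 2) ≤
      Real.log (Real.log x))
    (hc7 : 2 * Real.exp 60 ≤ Real.log x) (hz'2 : 2 ≤ z')
    (hz'z0 : z' ≤ Real.exp (Real.log x / Real.log (Real.log x))) :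
    ∃ (z₁ : ℝ) (r : ℕ) (lam : ℝ), 2 ≤ z₁ ∧ z₁ ≤ z' ∧ 1 < x ^ (εs / 8) ∧
      10 * Real.log z₁ ≤ Real.log (x ^ (εs / 8)) ∧ 0 < lam ∧
      ((2 * r + 1 : ℕ) : ℝ) * Real.log z' ≤ εs / 8 * Real.log x ∧
      2 * (2 * Real.exp 5 ^ 10 * Real.exp (10 - Real.log (x ^ (εs / 8)) / Real.log z₁) +
          (2 + 2 * (2 * Real.exp 5 ^ 10 * Real.exp (10 - Real.log (x ^ (εs / 8)) / Real.log z₁))) *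
            ((lam ^ (2 * r + 1))⁻¹ * Real.exp (lam * Real.log (Real.exp 5 * (Real.log z' / Real.log z₁))))) ≤
        10 * Real.log x ^ (-A') := by
  -- notation and basic facts
  have he1 : (2.7 : ℝ) < Real.exp 1 := by have := Real.exp_one_gt_d9; linarith
  have hx0 : 0 < x := (Real.exp_pos _).trans_le hxee
  set L : ℝ := Real.log x with hLdef
  set ell : ℝ := Real.log L with helldef
  have hLe : Real.exp 1 ≤ L := by rw [hLdef, Real.le_log_iff_exp_le hx0]; exact hxee
  have hL1 : 1 ≤ L := by linarith
  have hL0 : 0 < L := by linarith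
  have hx1 : 1 < x := (Real.log_pos_iff hx0.le).1 hL0
  have hell1 : 1 ≤ ell := by rw [helldef, Real.le_log_iff_exp_le hL0]; exact hLe
  have hell0 : 0 < ell := by linarith
  have hexpell : Real.exp ell = L := by rw [helldef, Real.exp_log hL0]
  set Λ' : ℝ := Real.exp 5 * (80 * A' / εs) with hΛ'
  have h80 : 1 ≤ 80 * A' / εs := by rw [le_div_iff₀ hεs]; linarith
  have hΛ'5 : Real.exp 5 ≤ Λ' := le_mul_of_one_le_right (Real.exp_pos 5).le h80
  have hΛ'pos : 0 < Λ' := (Real.exp_pos 5).trans_le hΛ'5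
  set Λl : ℝ := Real.log Λ' with hΛl
  have hΛl5 : 5 ≤ Λl := by rw [hΛl, Real.le_log_iff_exp_le hΛ'pos]; exact hΛ'5
  have hΛl1 : 1 ≤ Λl := by linarith
  -- the sifting range
  have hz'0 : 0 < z' := by linarith
  have hlogz' : Real.log z' ≤ L / ell := by
    have := Real.log_le_log hz'0 hz'z0; rwa [Real.log_exp] at this
  have hlogz'0 : 0 < Real.log z' := Real.log_pos (by linarith)
  -- the level
  set D₁ : ℝ := x ^ (εs / 8) with hD₁
  have hD1 : 1 < D₁ := Real.one_lt_rpow hx1 (by positivity)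
  have hlogD₁ : Real.log D₁ = εs / 8 * L := by rw [hD₁, Real.log_rpow hx0]
  -- the split point
  set Z₁ : ℝ := Real.exp (εs * L / (80 * A' * ell)) with hZ₁
  have hlogZ₁ : Real.log Z₁ = εs * L / (80 * A' * ell) := Real.log_exp _
  have hsqrtL : 80 * A' / εs ≤ Real.sqrt L := Real.le_sqrt_of_sq_le hc4
  have hellsqrt : ell ≤ Real.sqrt L := log_le_sqrt hL0
  have hLell2 : 80 * A' / εs ≤ L / ell := by
    have h1 : L / Real.sqrt L = Real.sqrt L := by
      rw [div_eq_iff (by positivity)]; exact (Real.mul_self_sqrt hL0.le).symm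
    calc 80 * A' / εs ≤ Real.sqrt L := hsqrtL
      _ = L / Real.sqrt L := h1.symm
      _ ≤ L / ell := div_le_div_of_nonneg_left hL0.le hell0 hellsqrt
  have hlogZ₁1 : 1 ≤ Real.log Z₁ := by
    rw [hlogZ₁, le_div_iff₀ (by positivity), one_mul]
    have h := (div_le_div_iff₀ hεs hell0).1 hLell2
    linarith
  have hZ₁2 : 2 ≤ Z₁ := by
    have : Real.exp 1 ≤ Z₁ := by
      rw [← Real.log_le_log_iff (Real.exp_pos 1) (Real.exp_pos _), Real.log_exp]; exact hlogZ₁1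
    linarith
  set z₁ : ℝ := min z' Z₁ with hz₁def
  have hz₁2 : 2 ≤ z₁ := le_min hz'2 hZ₁2
  have hz₁0 : 0 < z₁ := by linarith
  have hz₁z : z₁ ≤ z' := min_le_left _ _
  have hlogz₁Z : Real.log z₁ ≤ Real.log Z₁ := Real.log_le_log hz₁0 (min_le_right _ _)
  have hlogz₁0 : 0 < Real.log z₁ := Real.log_pos (by linarith)
  have hAell : 1 ≤ A' * ell := one_le_mul_of_one_le_of_one_le hA'1 hell1
  have hlogZ₁le : Real.log Z₁ ≤ εs * L / 80 := by
    rw [hlogZ₁, div_le_div_iff₀ (by positivity) (by norm_num)]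
    calc εs * L * 80 = εs * L * 80 * 1 := (mul_one _).symm
      _ ≤ εs * L * 80 * (A' * ell) := mul_le_mul_of_nonneg_left hAell (by positivity)
      _ = εs * L * (80 * A' * ell) := by ring
  have hzD : 10 * Real.log z₁ ≤ Real.log D₁ := by rw [hlogD₁]; linarith
  -- `η₁ ≤ L^{-A'}`
  have hs₁ : 10 * A' * ell ≤ Real.log D₁ / Real.log z₁ := by
    rw [le_div_iff₀ hlogz₁0, hlogD₁]
    calc 10 * A' * ell * Real.log z₁ ≤ 10 * A' * ell * Real.log Z₁ :=
          mul_le_mul_of_nonneg_left hlogz₁Z (by positivity)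
      _ = εs / 8 * L := by rw [hlogZ₁]; field_simp; ring
  set η₁ : ℝ := 2 * Real.exp 5 ^ 10 * Real.exp (10 - Real.log D₁ / Real.log z₁) with hη₁
  have hη₁0 : 0 ≤ η₁ := by positivity
  have hLA' : L ^ (-A') = Real.exp (-(A' * ell)) := by
    rw [← hexpell, ← Real.exp_mul]; ring_nf
  have hη₁le : η₁ ≤ L ^ (-A') := by
    have h1 : Real.exp (10 - Real.log D₁ / Real.log z₁) ≤ Real.exp 10 * Real.exp (-(10 * A' * ell)) := by
      rw [← Real.exp_add]; exact Real.exp_le_exp.2 (by linarith)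
    have h2 : η₁ ≤ 2 * Real.exp 60 * Real.exp (-(10 * A' * ell)) := by
      rw [hη₁, ← Real.exp_nat_mul, show ((10 : ℕ) : ℝ) * 5 = 50 by norm_num]
      calc 2 * Real.exp 50 * Real.exp (10 - Real.log D₁ / Real.log z₁)
          ≤ 2 * Real.exp 50 * (Real.exp 10 * Real.exp (-(10 * A' * ell))) :=
            mul_le_mul_of_nonneg_left h1 (by positivity)
        _ = 2 * Real.exp 60 * Real.exp (-(10 * A' * ell)) := by
            rw [show (60 : ℝ) = 50 + 10 by norm_num, Real.exp_add]; ring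
    have h3 : 2 * Real.exp 60 ≤ Real.exp (9 * A' * ell) := by
      have : ell ≤ 9 * A' * ell := by
        calc ell = 1 * ell := (one_mul _).symm
          _ ≤ 9 * A' * ell := mul_le_mul_of_nonneg_right (by linarith) hell0.le
      calc 2 * Real.exp 60 ≤ L := hc7
        _ = Real.exp ell := hexpell.symm
        _ ≤ Real.exp (9 * A' * ell) := Real.exp_le_exp.2 this
    rw [hLA']
    calc η₁ ≤ 2 * Real.exp 60 * Real.exp (-(10 * A' * ell)) := h2
      _ ≤ Real.exp (9 * A' * ell) * Real.exp (-(10 * A' * ell)) :=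
          mul_le_mul_of_nonneg_right h3 (Real.exp_pos _).le
      _ = Real.exp (-(A' * ell)) := by rw [← Real.exp_add]; ring_nf
  have hLA'1 : L ^ (-A') ≤ 1 := Real.rpow_le_one_of_one_le_of_nonpos hL1 (by linarith)
  have hη₁1 : η₁ ≤ 1 := hη₁le.trans hLA'1
  -- the Brun depth
  set t : ℝ := εs / 8 * ell with htdef
  have ht2 : 2 ≤ t := by
    rw [htdef]
    have h := (div_le_iff₀ hεs).1 hc5
    linarith
  set r : ℕ := ⌊(t - 1) / 2⌋₊ with hrdef
  have hr1 : ((r : ℝ)) ≤ (t - 1) / 2 := Nat.floor_le (by linarith)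
  have hr2 : (t - 1) / 2 < (r : ℝ) + 1 := Nat.lt_floor_add_one _
  have hk1 : ((2 * r + 1 : ℕ) : ℝ) ≤ t := by push_cast; linarith
  have hk2 : t - 2 ≤ ((2 * r + 1 : ℕ) : ℝ) := by push_cast; linarith
  have hk0 : (0 : ℝ) < ((2 * r + 1 : ℕ) : ℝ) := by positivity
  set lam : ℝ := ((2 * r + 1 : ℕ) : ℝ) / Λl with hlamdef
  have hlam : 0 < lam := by positivity
  -- the tail
  set T₀ : ℝ := (lam ^ (2 * r + 1))⁻¹ * Real.exp (lam * Real.log (Real.exp 5 * (Real.log z' / Real.log z₁))) with hT₀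
  have hratio : Real.exp 5 * (Real.log z' / Real.log z₁) ≤ Λ' := by
    refine mul_le_mul_of_nonneg_left ?_ (Real.exp_pos 5).le
    rcases min_cases z' Z₁ with ⟨h1, -⟩ | ⟨h1, -⟩
    · have : Real.log z' / Real.log z₁ = 1 := by rw [hz₁def, h1]; exact div_self hlogz'0.ne'
      rw [this]; exact h80
    · rw [hz₁def, h1, hlogZ₁, div_le_iff₀ (by positivity)]
      calc Real.log z' ≤ L / ell := hlogz'
        _ = 80 * A' / εs * (εs * L / (80 * A' * ell)) := by field_simp
  have hT₀le : T₀ ≤ (Real.exp 1 * Λl / ((2 * r + 1 : ℕ) : ℝ)) ^ (2 * r + 1) := by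
    have h1 : Real.log (Real.exp 5 * (Real.log z' / Real.log z₁)) ≤ Λl :=
      Real.log_le_log (by positivity) hratio
    have h2 : Real.exp (lam * Real.log (Real.exp 5 * (Real.log z' / Real.log z₁))) ≤
        Real.exp (((2 * r + 1 : ℕ) : ℝ)) := by
      refine Real.exp_le_exp.2 ?_
      calc lam * Real.log (Real.exp 5 * (Real.log z' / Real.log z₁)) ≤ lam * Λl :=
            mul_le_mul_of_nonneg_left h1 hlam.le
        _ = ((2 * r + 1 : ℕ) : ℝ) := by rw [hlamdef]; field_simp
    calc T₀ ≤ (lam ^ (2 * r + 1))⁻¹ * Real.exp (((2 * r + 1 : ℕ) : ℝ)) :=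
          mul_le_mul_of_nonneg_left h2 (by positivity)
      _ = (Real.exp 1 * Λl / ((2 * r + 1 : ℕ) : ℝ)) ^ (2 * r + 1) := by
          rw [← Real.exp_one_pow (2 * r + 1), hlamdef, div_pow, div_pow, mul_pow, inv_div]
          push_cast
          field_simp
  have hκ₁ : Real.exp 1 * Λl * Real.exp (16 * A' / εs) + 2 ≤ εs / 16 * ell := by
    have h := hc6
    rw [div_mul_eq_mul_div, div_le_iff₀ hεs] at h
    have : εs / 16 * ell = ell * εs / 16 := by ring
    rw [this, le_div_iff₀ (by norm_num : (0:ℝ) < 16)]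
    linarith
  have ht' : t = 2 * (εs / 16 * ell) := by rw [htdef]; ring
  have hkbig : Real.exp 1 * Λl * Real.exp (16 * A' / εs) ≤ ((2 * r + 1 : ℕ) : ℝ) := by
    have : 0 ≤ εs / 16 * ell := by positivity
    linarith
  have hksmall : εs / 16 * ell ≤ ((2 * r + 1 : ℕ) : ℝ) := by
    have : 0 ≤ Real.exp 1 * Λl * Real.exp (16 * A' / εs) := by positivity
    linarith
  have hT₀A : T₀ ≤ L ^ (-A') := by
    rw [hLA']
    exact hT₀le.trans (tail_pow_le hΛl1 hεs (by linarith) hkbig hksmall)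
  -- the level of the Brun part
  have hlevel : ((2 * r + 1 : ℕ) : ℝ) * Real.log z' ≤ εs / 8 * L := by
    calc ((2 * r + 1 : ℕ) : ℝ) * Real.log z' ≤ t * (L / ell) :=
          mul_le_mul hk1 hlogz' hlogz'0.le (by linarith)
      _ = εs / 8 * L := by rw [htdef]; field_simp
  refine ⟨z₁, r, lam, hz₁2, hz₁z, hD1, hzD, hlam, hlevel, ?_⟩
  -- `E = 2(η₁ + (2 + 2η₁) T₀) ≤ 2(L^{-A'} + 4 L^{-A'}) = 10 L^{-A'}`
  have hT₀0 : 0 ≤ T₀ := by positivity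
  show 2 * (η₁ + (2 + 2 * η₁) * T₀) ≤ 10 * L ^ (-A')
  have h1 : (2 + 2 * η₁) * T₀ ≤ 4 * L ^ (-A') := by
    calc (2 + 2 * η₁) * T₀ ≤ 4 * T₀ := mul_le_mul_of_nonneg_right (by linarith) hT₀0
      _ ≤ 4 * L ^ (-A') := by linarith
  linarith

/-! ### The sieve step for one box -/

/-- **The sieve step** (BFI p. 238 with the two-range weights): for nonnegative `β, γ, δ` with
`γ, δ ≤ τ^B`, a box `I = (⌊u⌋, ⌊v⌋]` with `0 ≤ u ≤ v`, `v − u ≤ M`, and a bound `B_d` for every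
bilinear piece `|∑_{m ∈ I, d ∣ m} F(m)|` with `d` below the level `D₁ z'^{2r+1}`:
`|∑_{m∈I} 1_{(m,P(z'))=1} F(m)| ≤ 2 B_d N_w + ‖β‖₁ (M E + 4 N_w) S_φ`
(`N_w` the support, `E` the main-term discrepancy, `S_φ = ∑_{q,r} τ(q)^{B+1}τ(r)^{B+1}/φ(qr)`).
[cite: BombieriFriedlanderIwaniecActa1986, §12 p. 238] -/
theorem core_sieve_step {a : ℤ} {z₁ z' D₁ u v lam M N Q R Bd : ℝ} {r B : ℕ} {β γ δ : ℕ → ℝ}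
    (hz₁ : 2 ≤ z₁) (hz : z₁ ≤ z') (hD1 : 1 < D₁) (hzD : 10 * Real.log z₁ ≤ Real.log D₁)
    (hu : 0 ≤ u) (huv : u ≤ v) (hvu : v - u ≤ M) (hlam : 0 < lam) (hQ : 0 ≤ Q) (hR : 0 ≤ R)
    (hβ : ∀ n, 0 ≤ β n) (hγ : ∀ q, 0 ≤ γ q) (hδ : ∀ r, 0 ≤ δ r)
    (hγB : ∀ q, γ q ≤ (σ 0 q : ℝ) ^ B) (hδB : ∀ r, δ r ≤ (σ 0 r : ℝ) ^ B) (hBd : 0 ≤ Bd)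
    (hpieces : ∀ d : ℕ, 0 < d → (d : ℝ) < D₁ * z' ^ (2 * r + 1) →
      |∑ m ∈ (Ioc ⌊u⌋₊ ⌊v⌋₊).filter (fun m : ℕ => d ∣ m), rowF a N Q R β γ δ m| ≤ Bd) :
    |∑ m ∈ Ioc ⌊u⌋₊ ⌊v⌋₊, (if m.Coprime (primesProdBelow z') then (1 : ℝ) else 0) * rowF a N Q R β γ δ m| ≤
      2 * Bd * (2 * (D₁ + 1) * ((TwoRangeSieve.midPrimes z₁ z').card + 1 : ℝ) ^ (2 * r + 1)) +
      (∑ n ∈ dyadic N, β n) *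
        (M * (2 * (2 * Real.exp 5 ^ 10 * Real.exp (10 - Real.log D₁ / Real.log z₁) +
            (2 + 2 * (2 * Real.exp 5 ^ 10 * Real.exp (10 - Real.log D₁ / Real.log z₁))) *
              ((lam ^ (2 * r + 1))⁻¹ * Real.exp (lam * Real.log (Real.exp 5 * (Real.log z' / Real.log z₁)))))) +
          4 * (2 * (D₁ + 1) * ((TwoRangeSieve.midPrimes z₁ z').card + 1 : ℝ) ^ (2 * r + 1))) *
        ∑ q ∈ dyadic Q, ∑ r' ∈ dyadic R,
          (σ 0 q : ℝ) ^ (B + 1) * (σ 0 r' : ℝ) ^ (B + 1) / (Nat.totient (q * r') : ℝ) := by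
  set I : Finset ℕ := Ioc ⌊u⌋₊ ⌊v⌋₊ with hI
  set J := TwoRangeSieve.idx z₁ z' with hJ
  set Nw : ℝ := 2 * (D₁ + 1) * ((TwoRangeSieve.midPrimes z₁ z').card + 1 : ℝ) ^ (2 * r + 1) with hNw
  have hz1 : 1 ≤ z' := by linarith
  -- the sieve functions
  obtain ⟨Uw, hUw⟩ : ∃ Uw : ℕ → ℝ, ∀ m, Uw m = ∑ i ∈ J, TwoRangeSieve.wU D₁ r i *
      (if TwoRangeSieve.modOf i ∣ m then (1 : ℝ) else 0) := ⟨_, fun m => rfl⟩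
  obtain ⟨Lw, hLw⟩ : ∃ Lw : ℕ → ℝ, ∀ m, Lw m = ∑ i ∈ J, TwoRangeSieve.wL D₁ r i *
      (if TwoRangeSieve.modOf i ∣ m then (1 : ℝ) else 0) := ⟨_, fun m => rfl⟩
  have hsand : ∀ m ∈ I, Lw m ≤ (if m.Coprime (primesProdBelow z') then (1 : ℝ) else 0) ∧
      (if m.Coprime (primesProdBelow z') then (1 : ℝ) else 0) ≤ Uw m := by
    intro m hm
    rw [hI, Finset.mem_Ioc] at hm
    have hm0 : m ≠ 0 := by omega
    rw [hUw, hLw]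
    exact TwoRangeSieve.sandwich hz D₁ r hm0
  -- the rows
  have hrow : ∀ m, rowF a N Q R β γ δ m = rowA a N Q R β γ δ m - rowB a N Q R β γ δ m :=
    fun m => rowF_eq_rowA_sub_rowB a N Q R β γ δ m
  simp_rw [hrow]
  refine (abs_sum_sandwich_le I (fun m hm => (hsand m hm).1) (fun m hm => (hsand m hm).2)
    (fun m _ => rowA_nonneg a N Q R hβ hγ hδ m) (fun m _ => (rowB_nonneg_le a N Q R hβ hγ hδ m).1)).trans ?_
  simp_rw [← hrow]
  -- the two weighted sums of rows
  have hpiece' : ∀ (w : ℕ × Finset ℕ → ℝ), (∀ i, |w i| ≤ |TwoRangeSieve.wU D₁ r i| + |TwoRangeSieve.wL D₁ r i|) →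
      (∀ i ∈ J, w i ≠ 0 → TwoRangeSieve.wU D₁ r i ≠ 0 ∨ TwoRangeSieve.wL D₁ r i ≠ 0) →
      |∑ m ∈ I, (∑ i ∈ J, w i * (if TwoRangeSieve.modOf i ∣ m then (1 : ℝ) else 0)) * rowF a N Q R β γ δ m| ≤
        Bd * Nw := by
    intro w hwabs hwsupp
    rw [sum_weightFn_mul_eq w J I]
    refine (abs_sum_weight_pieces_le w J _ (Bd := Bd) fun i hi hwi => ?_).trans ?_
    · have hlt := TwoRangeSieve.modOf_lt (r := r) hD1 hzD hz1 hi (hwsupp i hi hwi)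
      have hd0 : 0 < TwoRangeSieve.modOf i := by
        rw [hJ, TwoRangeSieve.idx, Finset.mem_product, Nat.mem_divisors, Finset.mem_powerset] at hi
        unfold TwoRangeSieve.modOf
        refine Nat.mul_pos (Nat.pos_of_ne_zero fun h0 => ?_) (Finset.prod_pos fun p hp =>
          (TwoRangeSieve.prime_of_mem_midPrimes (hi.2 hp)).pos)
        rw [h0] at hi; exact primesProdBelow_ne_zero z₁ (zero_dvd_iff.1 hi.1.1)
      exact hpieces _ hd0 hlt
    · refine mul_le_mul_of_nonneg_left ?_ hBd
      exact le_trans (Finset.sum_le_sum fun i _ => hwabs i) (TwoRangeSieve.sum_abs_w_le (z := z') (r := r) hD1 hzD)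
  have hU : |∑ m ∈ I, Uw m * rowF a N Q R β γ δ m| ≤ Bd * Nw := by
    simp_rw [hUw]
    exact hpiece' _ (fun i => le_add_of_nonneg_right (abs_nonneg _)) (fun i _ h => Or.inl h)
  have hL : |∑ m ∈ I, Lw m * rowF a N Q R β γ δ m| ≤ Bd * Nw := by
    simp_rw [hLw]
    exact hpiece' _ (fun i => le_add_of_nonneg_left (abs_nonneg _)) (fun i _ h => Or.inr h)
  -- the remainder
  have hrem := sum_UL_rowB_le (a := a) (N := N) (r := r) hz₁ hz hD1 hzD hu huv hvu hlam hQ hR hβ hγ hδ hγB hδB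
  have hUL : ∀ m, Uw m - Lw m = ∑ i ∈ J, (TwoRangeSieve.wU D₁ r i - TwoRangeSieve.wL D₁ r i) *
      (if TwoRangeSieve.modOf i ∣ m then (1 : ℝ) else 0) := by
    intro m; rw [hUw, hLw, ← Finset.sum_sub_distrib]
    exact Finset.sum_congr rfl fun i _ => by ring
  simp_rw [hUL]
  have e : 2 * Bd * Nw = Bd * Nw + Bd * Nw := by ring
  rw [e]
  exact add_le_add (add_le_add hU hL) hrem

/-! ### The final numerics -/

/-- The bookkeeping that turns the three terms of `core_sieve_step` into `2 ‖β‖ x^{1/2} M^{1/2} ℒ^{−A}`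
for large `x`. [folklore] -/
theorem core_numerics {x L M N ε εs A C₅ Cφ Bn b1 Nw E Sφ : ℝ} {cφ : ℕ} (hx : 1 < x)
    (hL1 : 1 ≤ L) (hεsε : εs ≤ ε) (hM : x ^ ε / 2 < M) (hM0 : 0 < M) (hN0 : 0 < N)
    (hsqrt : N ^ (1 / 2 : ℝ) * M = x ^ (1 / 2 : ℝ) * M ^ (1 / 2 : ℝ)) (hBn : 0 ≤ Bn)
    (hb1 : b1 ≤ 2 * Bn * N ^ (1 / 2 : ℝ)) (hC₅ : 0 ≤ C₅) (hCφ : 0 < Cφ) (hNw0 : 0 ≤ Nw)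
    (hNw : Nw ≤ x ^ (εs / 2)) (hE0 : 0 ≤ E) (hE : E ≤ 10 * L ^ (-(A + 2 * cφ + 2))) (hSφ0 : 0 ≤ Sφ)
    (hSφ : Sφ ≤ Cφ ^ 2 * (3 * L) ^ (2 * cφ)) (hc9 : 4 * C₅ * L ^ A ≤ x ^ (εs / 2))
    (hc10 : 40 * Cφ ^ 2 * 9 ^ cφ ≤ L) (hc11 : 32 * Cφ ^ 2 * 9 ^ cφ * L ^ (2 * cφ + A) ≤ x ^ (ε / 2)) :
    2 * (C₅ * Bn * x ^ (1 / 2 - εs) * M ^ (1 / 2 : ℝ)) * Nw + b1 * (M * E + 4 * Nw) * Sφ ≤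
      2 * Bn * x ^ (1 / 2 : ℝ) * M ^ (1 / 2 : ℝ) / L ^ A := by
  have hx0 : 0 < x := by linarith
  have hL0 : 0 < L := by linarith
  have hLA : 0 < L ^ A := Real.rpow_pos_of_pos hL0 A
  set W : ℝ := Bn * x ^ (1 / 2 : ℝ) * M ^ (1 / 2 : ℝ) / L ^ A with hW
  have hW0 : 0 ≤ W := by positivity
  have hxM : 0 ≤ x ^ (1 / 2 : ℝ) * M ^ (1 / 2 : ℝ) := by positivity
  -- Term 1
  have h1 : 2 * (C₅ * Bn * x ^ (1 / 2 - εs) * M ^ (1 / 2 : ℝ)) * Nw ≤ W / 2 := by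
    have hkey : C₅ * x ^ (-(εs / 2)) ≤ 1 / (4 * L ^ A) := by
      rw [le_div_iff₀ (by positivity)]
      calc C₅ * x ^ (-(εs / 2)) * (4 * L ^ A) = (4 * C₅ * L ^ A) * x ^ (-(εs / 2)) := by ring
        _ ≤ x ^ (εs / 2) * x ^ (-(εs / 2)) := mul_le_mul_of_nonneg_right hc9 (Real.rpow_nonneg hx0.le _)
        _ = 1 := by rw [← Real.rpow_add hx0]; norm_num
    have hsplit : x ^ (1 / 2 - εs) * Nw ≤ x ^ (1 / 2 : ℝ) * x ^ (-(εs / 2)) := by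
      calc x ^ (1 / 2 - εs) * Nw ≤ x ^ (1 / 2 - εs) * x ^ (εs / 2) :=
            mul_le_mul_of_nonneg_left hNw (Real.rpow_nonneg hx0.le _)
        _ = x ^ (1 / 2 : ℝ) * x ^ (-(εs / 2)) := by
            rw [← Real.rpow_add hx0, ← Real.rpow_add hx0]; ring_nf
    calc 2 * (C₅ * Bn * x ^ (1 / 2 - εs) * M ^ (1 / 2 : ℝ)) * Nw
        = 2 * Bn * M ^ (1 / 2 : ℝ) * C₅ * (x ^ (1 / 2 - εs) * Nw) := by ring
      _ ≤ 2 * Bn * M ^ (1 / 2 : ℝ) * C₅ * (x ^ (1 / 2 : ℝ) * x ^ (-(εs / 2))) :=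
          mul_le_mul_of_nonneg_left hsplit (by positivity)
      _ = 2 * Bn * x ^ (1 / 2 : ℝ) * M ^ (1 / 2 : ℝ) * (C₅ * x ^ (-(εs / 2))) := by ring
      _ ≤ 2 * Bn * x ^ (1 / 2 : ℝ) * M ^ (1 / 2 : ℝ) * (1 / (4 * L ^ A)) :=
          mul_le_mul_of_nonneg_left hkey (by positivity)
      _ = W / 2 := by rw [hW]; field_simp; ring
  -- the divisor sums against the powers of `L`
  have hpowA : L ^ (2 * cφ) * L ^ (-(A + 2 * cφ + 2)) = (L ^ A)⁻¹ * (L ^ 2)⁻¹ := by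
    rw [show -(A + 2 * cφ + 2) = -A + -(2 : ℝ) + -((2 * cφ : ℕ) : ℝ) by push_cast; ring,
      Real.rpow_add hL0, Real.rpow_add hL0, Real.rpow_neg hL0.le A, Real.rpow_neg hL0.le 2,
      Real.rpow_neg hL0.le, Real.rpow_natCast, Real.rpow_two]
    field_simp
  -- Term 2a
  have h2a : b1 * (M * E) * Sφ ≤ W / 2 := by
    have hL2 : 40 * Cφ ^ 2 * 9 ^ cφ ≤ L ^ 2 := by nlinarith
    calc b1 * (M * E) * Sφ ≤ (2 * Bn * N ^ (1 / 2 : ℝ)) * (M * (10 * L ^ (-(A + 2 * cφ + 2)))) *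
          (Cφ ^ 2 * (3 * L) ^ (2 * cφ)) := by
          refine mul_le_mul (mul_le_mul hb1 (mul_le_mul_of_nonneg_left hE hM0.le) (by positivity)
            (by positivity)) hSφ hSφ0 (by positivity)
      _ = 20 * Cφ ^ 2 * 3 ^ (2 * cφ) * (Bn * (N ^ (1 / 2 : ℝ) * M)) * (L ^ (2 * cφ) * L ^ (-(A + 2 * cφ + 2))) := by
          rw [mul_pow]; ring
      _ = 20 * Cφ ^ 2 * 9 ^ cφ * (Bn * (x ^ (1 / 2 : ℝ) * M ^ (1 / 2 : ℝ))) * ((L ^ A)⁻¹ * (L ^ 2)⁻¹) := by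
          rw [hsqrt, hpowA, pow_mul]; norm_num
      _ = W * (20 * Cφ ^ 2 * 9 ^ cφ / L ^ 2) := by rw [hW]; field_simp
      _ ≤ W * (1 / 2) := by
          refine mul_le_mul_of_nonneg_left ?_ hW0
          rw [div_le_iff₀ (by positivity)]; linarith
      _ = W / 2 := by ring
  -- Term 2b
  have h2b : b1 * (4 * Nw) * Sφ ≤ W / 2 := by
    have hxsum : x ^ (εs / 2) * x ^ (ε / 2) ≤ x ^ ε := by
      rw [← Real.rpow_add hx0]; exact Real.rpow_le_rpow_of_exponent_le hx.le (by linarith)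
    have hMbig : 16 * Cφ ^ 2 * 9 ^ cφ * L ^ (2 * cφ + A) * x ^ (εs / 2) ≤ M := by
      calc 16 * Cφ ^ 2 * 9 ^ cφ * L ^ (2 * cφ + A) * x ^ (εs / 2)
          = (32 * Cφ ^ 2 * 9 ^ cφ * L ^ (2 * cφ + A)) * x ^ (εs / 2) / 2 := by ring
        _ ≤ x ^ (ε / 2) * x ^ (εs / 2) / 2 := by
            refine div_le_div_of_nonneg_right (mul_le_mul_of_nonneg_right hc11 (Real.rpow_nonneg hx0.le _)) (by norm_num)
        _ ≤ x ^ ε / 2 := by rw [mul_comm]; exact div_le_div_of_nonneg_right hxsum (by norm_num)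
        _ ≤ M := hM.le
    have hpow2 : (L ^ (2 * cφ) : ℝ) = L ^ (2 * cφ + A) * (L ^ A)⁻¹ := by
      rw [Real.rpow_add hL0, ← Real.rpow_natCast]; push_cast; field_simp
    calc b1 * (4 * Nw) * Sφ ≤ (2 * Bn * N ^ (1 / 2 : ℝ)) * (4 * x ^ (εs / 2)) * (Cφ ^ 2 * (3 * L) ^ (2 * cφ)) := by
          refine mul_le_mul (mul_le_mul hb1 (by linarith) (by positivity) (by positivity)) hSφ hSφ0 (by positivity)
      _ = Bn * N ^ (1 / 2 : ℝ) * (L ^ A)⁻¹ * (8 * Cφ ^ 2 * 9 ^ cφ * L ^ (2 * cφ + A) * x ^ (εs / 2)) := by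
          rw [mul_pow, pow_mul, hpow2]; norm_num; ring
      _ ≤ Bn * N ^ (1 / 2 : ℝ) * (L ^ A)⁻¹ * (M / 2) := by
          refine mul_le_mul_of_nonneg_left ?_ (by positivity)
          linarith
      _ = W / 2 := by
          rw [hW, mul_assoc Bn (x ^ (1 / 2 : ℝ)), ← hsqrt]; field_simp
  calc 2 * (C₅ * Bn * x ^ (1 / 2 - εs) * M ^ (1 / 2 : ℝ)) * Nw + b1 * (M * E + 4 * Nw) * Sφ
      = 2 * (C₅ * Bn * x ^ (1 / 2 - εs) * M ^ (1 / 2 : ℝ)) * Nw + (b1 * (M * E) * Sφ + b1 * (4 * Nw) * Sφ) := by ring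
    _ ≤ W / 2 + (W / 2 + W / 2) := add_le_add h1 (add_le_add h2a h2b)
    _ ≤ 2 * W := by linarith
    _ = 2 * Bn * x ^ (1 / 2 : ℝ) * M ^ (1 / 2 : ℝ) / L ^ A := by rw [hW]; ring

/-! ### The core estimate: nonnegative coefficients, one box -/

/-- `#𝒫₂ + 1 ≤ 2z'`: the primes of `[z₁, z')` number at most `⌈z'⌉ ≤ z' + 1`. [folklore] -/
theorem card_midPrimes_add_one_le {z₁ z' : ℝ} (hz' : 2 ≤ z') :
    ((TwoRangeSieve.midPrimes z₁ z').card + 1 : ℝ) ≤ 2 * z' := by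
  have h1 : (TwoRangeSieve.midPrimes z₁ z').card ≤ ⌈z'⌉₊ := by
    calc (TwoRangeSieve.midPrimes z₁ z').card ≤ (Nat.primesBelow ⌈z'⌉₊).card := Finset.card_filter_le _ _
      _ ≤ (Finset.range ⌈z'⌉₊).card := Finset.card_le_card (Finset.filter_subset _ _)
      _ = ⌈z'⌉₊ := Finset.card_range _
  have h2 : ((TwoRangeSieve.midPrimes z₁ z').card : ℝ) ≤ ⌈z'⌉₊ := by exact_mod_cast h1
  have h3 : (⌈z'⌉₊ : ℝ) < z' + 1 := Nat.ceil_lt_add_one (by linarith)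
  linarith

set_option maxHeartbeats 1600000 in
/-- **The core of Theorem 5* from Theorem 5** (BFI p. 238, made effective with the two-range
weights): given the boxed Theorem 5 bound with `ε/2` and saving `x^{−ε_s}`, for `x ≥ x₀`, under
(A₁), (12.5), `z ≤ exp(log x/log log x)`, a box `(u,v] ⊆ [M, 2M]` and NONNEGATIVE `β, γ, δ` with
`γ ≤ τ^B`, `δ ≤ τ^B`: `|∑_{u<m≤v} 1_{(m,P(z))=1} F(m)| ≤ 2 ‖β‖ x^{1/2} M^{1/2} ℒ^{−A}`.
[cite: BombieriFriedlanderIwaniecActa1986, §12 Theorem 5* p. 238] -/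
theorem core_bound (a : ℤ) {ε : ℝ} (hε : 0 < ε) {A : ℝ} (hA : 0 < A) (B : ℕ)
    {εs C₅ x₅ : ℝ} (hεs : 0 < εs) (hεsε : εs ≤ ε / 2) (hεs4 : εs ≤ 1 / 4) (hC₅ : 0 ≤ C₅)
    (h5 : ∀ x : ℝ, x₅ ≤ x → ∀ M N Q R : ℝ, M * N = x → x ^ (ε / 2) ≤ N → N ≤ x ^ (1 - ε / 2) →
      1 / 2 ≤ Q → 1 / 2 ≤ R → Q * R < x → x ^ (ε / 2) * thm5Threshold x Q R < M →
      ∀ M₁ M₂ : ℝ, ∀ β γ δ : ℕ → ℝ, (∀ q, |γ q| ≤ (σ 0 q : ℝ) ^ B) → (∀ r, |δ r| ≤ (σ 0 r : ℝ) ^ B) →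
        |dispD a M N Q R (fun m => if M₁ < (m : ℝ) ∧ (m : ℝ) ≤ M₂ then 1 else 0) β γ δ| ≤
          C₅ * Real.sqrt (l2Sq N β) * x ^ (1 / 2 - εs) * M ^ (1 / 2 : ℝ)) :
    ∃ x₀ : ℝ, ∀ x : ℝ, x₀ ≤ x → ∀ M N Q R : ℝ,
      M * N = x → x ^ ε ≤ N → N ≤ x ^ (1 - ε) → 1 / 2 ≤ Q → 1 / 2 ≤ R → Q * R < x →
      x ^ ε * thm5Threshold x Q R < M →
      ∀ z : ℝ, z ≤ Real.exp (Real.log x / Real.log (Real.log x)) →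
      ∀ u v : ℝ, M ≤ u → u ≤ v → v ≤ 2 * M →
      ∀ β γ δ : ℕ → ℝ, (∀ n, 0 ≤ β n) → (∀ q, 0 ≤ γ q) → (∀ r, 0 ≤ δ r) →
        (∀ q, |γ q| ≤ (σ 0 q : ℝ) ^ B) → (∀ r, |δ r| ≤ (σ 0 r : ℝ) ^ B) →
        |boxSum (fun m => roughIndicator z m * rowF a N Q R β γ δ m) u v| ≤
          2 * Real.sqrt (l2Sq N β) * x ^ (1 / 2 : ℝ) * M ^ (1 / 2 : ℝ) / Real.log x ^ A := by
  -- constants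
  obtain ⟨Cφ, hCφ, hφ⟩ := exists_sum_sigma_zero_pow_div_totient_le_real (B + 1)
  set cφ : ℕ := 2 ^ (B + 1 + 2) with hcφ
  set A' : ℝ := A + 2 * cφ + 2 with hA'
  have hA'1 : 1 ≤ A' := by rw [hA']; have : (0:ℝ) ≤ cφ := Nat.cast_nonneg _; linarith
  obtain ⟨x₀, hx₀⟩ := core_eventually hε hεs hA.le x₅ ((80 * A' / εs) ^ 2) (16 / εs)
    (16 / εs * (Real.exp 1 * Real.log (Real.exp 5 * (80 * A' / εs)) * Real.exp (16 * A' / εs) + 2))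
    (2 * Real.exp 60) (4 * C₅) (40 * Cφ ^ 2 * 9 ^ cφ) (32 * Cφ ^ 2 * 9 ^ cφ) (by positivity) (by positivity)
    (2 * cφ + A) (by positivity)
  refine ⟨x₀, fun x hx M N Q R hMN hN1 hN2 hQ hR hQR hthr z hz u v hMu huv hv β γ δ hβ hγ hδ hγB hδB => ?_⟩
  obtain ⟨hx3, hxee, hx₅, hc4, hc5, hc6, hc7, hc8, hc9, hc10, hc11⟩ := hx₀ x hx
  -- basic facts
  have hx0 : 0 < x := by linarith
  have hx1 : 1 < x := by linarith
  set L : ℝ := Real.log x with hLdef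
  have he1 : (2.7 : ℝ) < Real.exp 1 := by have := Real.exp_one_gt_d9; linarith
  have hLe : Real.exp 1 ≤ L := by rw [hLdef, Real.le_log_iff_exp_le hx0]; exact hxee
  have hL1 : 1 ≤ L := by linarith
  have hL0 : 0 < L := by linarith
  have hell0 : 0 < Real.log L := Real.log_pos (by linarith)
  have hxε : 0 < x ^ ε := Real.rpow_pos_of_pos hx0 ε
  have hN0 : 0 < N := hxε.trans_le hN1
  have hTQ : Q ≤ thm5Threshold x Q R := le_trans (le_max_left _ _) (le_max_left _ _)
  have hT0 : 0 ≤ thm5Threshold x Q R := le_trans (by linarith) hTQ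
  have hM0 : 0 < M := lt_of_le_of_lt (mul_nonneg hxε.le hT0) hthr
  have hMε : x ^ ε / 2 < M := by
    have h1 : x ^ ε * Q < M := lt_of_le_of_lt (mul_le_mul_of_nonneg_left hTQ hxε.le) hthr
    have h2 : x ^ ε * (1 / 2) ≤ x ^ ε * Q := mul_le_mul_of_nonneg_left hQ hxε.le
    linarith
  obtain ⟨-, hQx, hRx⟩ := QR_lt_of_thm5Threshold hx1 hMN hN1 hQ (by linarith) hthr
  have hsqrt : N ^ (1 / 2 : ℝ) * M = x ^ (1 / 2 : ℝ) * M ^ (1 / 2 : ℝ) := by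
    have hM12 : M ^ (1 / 2 : ℝ) * M ^ (1 / 2 : ℝ) = M := by rw [← Real.rpow_add hM0]; norm_num
    calc N ^ (1 / 2 : ℝ) * M = N ^ (1 / 2 : ℝ) * (M ^ (1 / 2 : ℝ) * M ^ (1 / 2 : ℝ)) := by rw [hM12]
      _ = (N * M) ^ (1 / 2 : ℝ) * M ^ (1 / 2 : ℝ) := by rw [Real.mul_rpow hN0.le hM0.le]; ring
      _ = x ^ (1 / 2 : ℝ) * M ^ (1 / 2 : ℝ) := by rw [mul_comm N M, hMN]
  have hu0 : 0 ≤ u := hM0.le.trans hMu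
  have hv0 : 0 ≤ v := hu0.trans huv
  -- the sifting range `z' = max z 2`
  set z' : ℝ := max z 2 with hz'def
  have hz'2 : 2 ≤ z' := le_max_right _ _
  have hz'0 : 0 < z' := by linarith
  have hLell : 1 ≤ L / Real.log L := by
    rw [le_div_iff₀ hell0, one_mul]
    exact (Real.log_le_sub_one_of_pos hL0).trans (by linarith)
  have hz'z0 : z' ≤ Real.exp (L / Real.log L) := by
    refine max_le hz ?_
    calc (2 : ℝ) ≤ Real.exp 1 := by linarith
      _ ≤ Real.exp (L / Real.log L) := Real.exp_le_exp.2 hLell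
  -- rewrite the sum
  have hsum : boxSum (fun m => roughIndicator z m * rowF a N Q R β γ δ m) u v =
      ∑ m ∈ Ioc ⌊u⌋₊ ⌊v⌋₊, (if m.Coprime (primesProdBelow z') then (1 : ℝ) else 0) * rowF a N Q R β γ δ m := by
    unfold boxSum
    refine Finset.sum_congr rfl fun m hm => ?_
    rw [Finset.mem_Ioc] at hm
    show roughIndicator z m * _ = _
    rw [← roughIndicator_max_two z m, roughIndicator_eq_coprime_ite _ (by omega : m ≠ 0)]
  rw [hsum]
  -- parameters
  obtain ⟨z₁, r, lam, hz₁2, hz₁z, hD1, hzD, hlam, hlevel, hE⟩ :=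
    core_params hεs hεs4 hA'1 hxee hc4 hc5 hc6 hc7 hz'2 hz'z0
  set D₁ : ℝ := x ^ (εs / 8) with hD₁
  -- the level of the weights is `≤ x^{εs/4} ≤ x^{ε/2}`
  have hzk : z' ^ (2 * r + 1) ≤ x ^ (εs / 8) := by
    have h1 : z' ^ (2 * r + 1) = Real.exp (((2 * r + 1 : ℕ) : ℝ) * Real.log z') := by
      rw [← Real.rpow_natCast, Real.rpow_def_of_pos hz'0]; ring_nf
    rw [h1, Real.rpow_def_of_pos hx0]
    refine Real.exp_le_exp.2 ?_
    have h2 := hlevel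
    rw [← hLdef] at h2
    linarith
  have hDz : D₁ * z' ^ (2 * r + 1) ≤ x ^ (ε / 2) := by
    calc D₁ * z' ^ (2 * r + 1) ≤ x ^ (εs / 8) * x ^ (εs / 8) :=
          mul_le_mul_of_nonneg_left hzk (Real.rpow_nonneg hx0.le _)
      _ = x ^ (εs / 4) := by rw [← Real.rpow_add hx0]; ring_nf
      _ ≤ x ^ (ε / 2) := Real.rpow_le_rpow_of_exponent_le hx1.le (by linarith)
  -- the bilinear pieces
  set Bd : ℝ := C₅ * Real.sqrt (l2Sq N β) * x ^ (1 / 2 - εs) * M ^ (1 / 2 : ℝ) with hBd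
  have hBd0 : 0 ≤ Bd := by positivity
  have hpieces : ∀ d : ℕ, 0 < d → (d : ℝ) < D₁ * z' ^ (2 * r + 1) →
      |∑ m ∈ (Ioc ⌊u⌋₊ ⌊v⌋₊).filter (fun m : ℕ => d ∣ m), rowF a N Q R β γ δ m| ≤ Bd := by
    intro d hd hdlt
    refine abs_sum_filter_dvd_rowF_le (εs := εs) (fun M' N' hMN' hN1' hN2' hthr' M₁ M₂ β' =>
      h5 x hx₅ M' N' Q R hMN' hN1' hN2' hQ hR hQR hthr' M₁ M₂ β' γ δ hγB hδB)
      hx1 hε hMN hN1 hN2 hQ hthr hC₅ hMu huv hv hd (le_of_lt (hdlt.trans_le hDz))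
  -- the sieve step
  have hγB' : ∀ q, γ q ≤ (σ 0 q : ℝ) ^ B := fun q => (le_abs_self _).trans (hγB q)
  have hδB' : ∀ r, δ r ≤ (σ 0 r : ℝ) ^ B := fun r => (le_abs_self _).trans (hδB r)
  have hvu : v - u ≤ M := by linarith
  have hstep := core_sieve_step (a := a) (N := N) (M := M) (r := r) hz₁2 hz₁z hD1 hzD hu0 huv hvu hlam
    (by linarith : (0:ℝ) ≤ Q) (by linarith : (0:ℝ) ≤ R) hβ hγ hδ hγB' hδB' hBd0 hpieces
  refine hstep.trans ?_
  -- sizes of the three terms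
  set Nw : ℝ := 2 * (D₁ + 1) * ((TwoRangeSieve.midPrimes z₁ z').card + 1 : ℝ) ^ (2 * r + 1) with hNw
  have hNw0 : 0 ≤ Nw := by positivity
  have hNw : Nw ≤ x ^ (εs / 2) := by
    have h1 : ((TwoRangeSieve.midPrimes z₁ z').card + 1 : ℝ) ^ (2 * r + 1) ≤ x ^ (εs / 8) * x ^ (εs / 8) := by
      calc ((TwoRangeSieve.midPrimes z₁ z').card + 1 : ℝ) ^ (2 * r + 1) ≤ (2 * z') ^ (2 * r + 1) :=
            pow_le_pow_left₀ (by positivity) (card_midPrimes_add_one_le hz'2) _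
        _ = 2 ^ (2 * r + 1) * z' ^ (2 * r + 1) := mul_pow _ _ _
        _ ≤ z' ^ (2 * r + 1) * z' ^ (2 * r + 1) :=
            mul_le_mul_of_nonneg_right (pow_le_pow_left₀ (by norm_num) hz'2 _) (by positivity)
        _ ≤ x ^ (εs / 8) * x ^ (εs / 8) := mul_le_mul hzk hzk (by positivity) (Real.rpow_nonneg hx0.le _)
    have h2 : D₁ + 1 ≤ 2 * x ^ (εs / 8) := by rw [hD₁]; linarith [hD1.le]
    calc Nw ≤ 2 * (2 * x ^ (εs / 8)) * (x ^ (εs / 8) * x ^ (εs / 8)) := by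
          rw [hNw]; exact mul_le_mul (mul_le_mul_of_nonneg_left h2 (by norm_num)) h1 (by positivity) (by positivity)
      _ = 4 * x ^ (3 * εs / 8) := by
          rw [show (3 : ℝ) * εs / 8 = εs / 8 + (εs / 8 + εs / 8) by ring, Real.rpow_add hx0, Real.rpow_add hx0]; ring
      _ ≤ x ^ (εs / 8) * x ^ (3 * εs / 8) := mul_le_mul_of_nonneg_right hc8 (Real.rpow_nonneg hx0.le _)
      _ = x ^ (εs / 2) := by rw [← Real.rpow_add hx0]; ring_nf
  set Sφ : ℝ := ∑ q ∈ dyadic Q, ∑ r' ∈ dyadic R,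
      (σ 0 q : ℝ) ^ (B + 1) * (σ 0 r' : ℝ) ^ (B + 1) / (Nat.totient (q * r') : ℝ) with hSφ
  have hSφ0 : 0 ≤ Sφ := Finset.sum_nonneg fun _ _ => Finset.sum_nonneg fun _ _ => by positivity
  have hlog2xx : Real.log (2 * x ^ 2) ≤ 3 * L := by
    have hlog2 : Real.log 2 ≤ L := Real.log_le_log (by norm_num) (by linarith)
    rw [Real.log_mul (by norm_num) (by positivity), Real.log_pow]; push_cast; linarith
  have hone : ∀ {T : ℝ}, 0 ≤ T → T ≤ x ^ 2 →
      ∑ q ∈ Icc 1 ⌊2 * max T 1⌋₊, (σ 0 q : ℝ) ^ (B + 1) / (Nat.totient q : ℝ) ≤ Cφ * (3 * L) ^ cφ := by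
    intro T hT hTx
    have h2 : (2 : ℝ) ≤ 2 * max T 1 := by linarith [le_max_right T 1]
    have hx2 : (1 : ℝ) ≤ x ^ 2 := one_le_pow₀ hx1.le
    refine (hφ _ h2).trans (mul_le_mul_of_nonneg_left (pow_le_pow_left₀ (Real.log_nonneg (by linarith))
      ((Real.log_le_log (by linarith) ?_).trans hlog2xx) _) hCφ.le)
    exact mul_le_mul_of_nonneg_left (max_le hTx hx2) (by norm_num)
  have hx1ε : x ^ (1 - 2 * ε) ≤ x := by
    calc x ^ (1 - 2 * ε) ≤ x ^ (1 : ℝ) := Real.rpow_le_rpow_of_exponent_le hx1.le (by linarith)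
      _ = x := Real.rpow_one x
  have hxx : 2 * x ≤ x ^ 2 := by
    rw [sq]; exact mul_le_mul_of_nonneg_right (by linarith) hx0.le
  have hQx2 : Q ≤ x ^ 2 := by linarith
  have hRx2 : R ≤ x ^ 2 := by linarith
  have hSφle : Sφ ≤ Cφ ^ 2 * (3 * L) ^ (2 * cφ) := by
    refine (sum_sum_sigma_pow_div_totient_le (B + 1) (by linarith : (0:ℝ) ≤ Q) (by linarith : (0:ℝ) ≤ R)).trans ?_
    calc (∑ q ∈ Icc 1 ⌊2 * max Q 1⌋₊, (σ 0 q : ℝ) ^ (B + 1) / (Nat.totient q : ℝ)) *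
          ∑ r' ∈ Icc 1 ⌊2 * max R 1⌋₊, (σ 0 r' : ℝ) ^ (B + 1) / (Nat.totient r' : ℝ)
        ≤ (Cφ * (3 * L) ^ cφ) * (Cφ * (3 * L) ^ cφ) :=
          mul_le_mul (hone (by linarith) hQx2) (hone (by linarith) hRx2)
            (Finset.sum_nonneg fun _ _ => by positivity) (by positivity)
      _ = Cφ ^ 2 * (3 * L) ^ (2 * cφ) := by rw [two_mul, pow_add]; ring
  -- `‖β‖₁ ≤ 2 ‖β‖ N^{1/2}`
  have hb1 : ∑ n ∈ dyadic N, β n ≤ 2 * Real.sqrt (l2Sq N β) * N ^ (1 / 2 : ℝ) := by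
    have hN1' : 1 ≤ N := le_trans (Real.one_le_rpow hx1.le hε.le) hN1
    have h0 : ∑ n ∈ dyadic N, β n = ∑ n ∈ dyadic N, |β n| :=
      Finset.sum_congr rfl fun n _ => (abs_of_nonneg (hβ n)).symm
    rw [h0]
    refine (sum_abs_le_sqrt_l2Sq hN0.le β).trans ?_
    have h1 : Real.sqrt (2 * N + 1) ≤ 2 * N ^ (1 / 2 : ℝ) := by
      rw [← Real.sqrt_eq_rpow]
      calc Real.sqrt (2 * N + 1) ≤ Real.sqrt (4 * N) := Real.sqrt_le_sqrt (by linarith)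
        _ = Real.sqrt 4 * Real.sqrt N := Real.sqrt_mul (by norm_num) N
        _ = 2 * Real.sqrt N := by rw [show (4 : ℝ) = 2 ^ 2 by norm_num, Real.sqrt_sq (by norm_num)]
    calc Real.sqrt (l2Sq N β) * Real.sqrt (2 * N + 1) ≤ Real.sqrt (l2Sq N β) * (2 * N ^ (1 / 2 : ℝ)) :=
          mul_le_mul_of_nonneg_left h1 (Real.sqrt_nonneg _)
      _ = _ := by ring
  -- the main-term discrepancy
  have hE' : 2 * (2 * Real.exp 5 ^ 10 * Real.exp (10 - Real.log D₁ / Real.log z₁) +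
      (2 + 2 * (2 * Real.exp 5 ^ 10 * Real.exp (10 - Real.log D₁ / Real.log z₁))) *
        ((lam ^ (2 * r + 1))⁻¹ * Real.exp (lam * Real.log (Real.exp 5 * (Real.log z' / Real.log z₁))))) ≤
      10 * L ^ (-(A + 2 * cφ + 2)) := by rw [hD₁]; exact hE
  have hE0 : 0 ≤ 2 * (2 * Real.exp 5 ^ 10 * Real.exp (10 - Real.log D₁ / Real.log z₁) +
      (2 + 2 * (2 * Real.exp 5 ^ 10 * Real.exp (10 - Real.log D₁ / Real.log z₁))) *
        ((lam ^ (2 * r + 1))⁻¹ * Real.exp (lam * Real.log (Real.exp 5 * (Real.log z' / Real.log z₁))))) := by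
    positivity
  -- conclusion
  have hfinal := core_numerics (cφ := cφ) hx1 hL1 (by linarith : εs ≤ ε) hMε hM0 hN0 hsqrt (Real.sqrt_nonneg (l2Sq N β))
    hb1 hC₅ hCφ hNw0 hNw hE0 hE' hSφ0 hSφle hc9 hc10 hc11
  rw [hBd]
  exact hfinal

end BFI

open BFI

/-- **Theorem 5* (as applied in §15) from Theorem 5.**  The named fact
`Literature.NumberTheory.Sieve.BombieriFriedlanderIwaniecTheorem5StarInterval` — BFI's Theorem 5*
(§12, p. 238) with the coefficients (A₆*) restricted to a box, for every sifting range
`z ≤ exp(log x / log log x)` and every `A` — FOLLOWS from the printed Theorem 5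
(`Literature.NumberTheory.Sieve.BombieriFriedlanderIwaniecTheorem5`, §12 p. 237).  This is the
printed proof (p. 238: "Theorem 5* can be easily derived from Theorem 5 by means of a sieve method
of Fundamental Lemma type") made effective: the Fundamental Lemma needed there must save an
arbitrary power of `ℒ` at `s = log D/log z ≍ log log x`, i.e. be of quality `exp(−s log s)`
(Lemma 4 of the source); it is supplied here by the two-range composite weights of
`Literature.NumberTheory.Sieve.TwoRangeSieve` (beta-sieve of quality `e^{−s}` below
`z₁ = z^{O(1/(A log log x))…}`, Brun's pure sieve on `[z₁, z)`), while Theorem 5 is applied to the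
bilinear pieces `E_d` through its boxed form `…Theorem5.interval`.  Consequently both
`…Theorem5StarInterval` and the printed `…Theorem5Star` (via `…Interval.theorem5Star`) rest on the
printed Theorem 5 alone.
[cite: BombieriFriedlanderIwaniecActa1986, §12 Theorem 5* p. 238, §2 Lemma 4 p. 211] -/
theorem BombieriFriedlanderIwaniecTheorem5StarInterval_of_theorem5 (h5 : BombieriFriedlanderIwaniecTheorem5) :
    BombieriFriedlanderIwaniecTheorem5StarInterval := by
  intro a ha ε hε A hA B hB
  -- Theorem 5 on boxes with `ε/2` and the divisor exponent `⌈B⌉`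
  obtain ⟨ε', C', x₅, hε', h5i⟩ :=
    BombieriFriedlanderIwaniecTheorem5.interval h5 a ha (ε / 2) (half_pos hε) (⌈B⌉₊ : ℝ) (Nat.cast_nonneg _)
  set εs : ℝ := min ε' (min (ε / 2) (1 / 4)) with hεs
  have hεs0 : 0 < εs := lt_min hε' (lt_min (half_pos hε) (by norm_num))
  have hεsε' : εs ≤ ε' := min_le_left _ _
  have hεsε : εs ≤ ε / 2 := (min_le_right _ _).trans (min_le_left _ _)
  have hεs4 : εs ≤ 1 / 4 := (min_le_right _ _).trans (min_le_right _ _)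
  set C₅ : ℝ := max C' 0 with hC₅
  have hC₅0 : 0 ≤ C₅ := le_max_right _ _
  have h5' : ∀ x : ℝ, max x₅ 1 ≤ x → ∀ M N Q R : ℝ, M * N = x → x ^ (ε / 2) ≤ N → N ≤ x ^ (1 - ε / 2) →
      1 / 2 ≤ Q → 1 / 2 ≤ R → Q * R < x → x ^ (ε / 2) * thm5Threshold x Q R < M →
      ∀ M₁ M₂ : ℝ, ∀ β γ δ : ℕ → ℝ, (∀ q, |γ q| ≤ (σ 0 q : ℝ) ^ ⌈B⌉₊) → (∀ r, |δ r| ≤ (σ 0 r : ℝ) ^ ⌈B⌉₊) →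
        |dispD a M N Q R (fun m => if M₁ < (m : ℝ) ∧ (m : ℝ) ≤ M₂ then 1 else 0) β γ δ| ≤
          C₅ * Real.sqrt (l2Sq N β) * x ^ (1 / 2 - εs) * M ^ (1 / 2 : ℝ) := by
    intro x hx M N Q R hMN hN1 hN2 hQ hR hQR hthr M₁ M₂ β γ δ hγ hδ
    have hx₅ : x₅ ≤ x := le_trans (le_max_left _ _) hx
    have hx1 : 1 ≤ x := le_trans (le_max_right _ _) hx
    have hγ' : ∀ q, |γ q| ≤ (σ 0 q : ℝ) ^ ((⌈B⌉₊ : ℕ) : ℝ) := fun q => by rw [Real.rpow_natCast]; exact hγ q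
    have hδ' : ∀ r, |δ r| ≤ (σ 0 r : ℝ) ^ ((⌈B⌉₊ : ℕ) : ℝ) := fun r => by rw [Real.rpow_natCast]; exact hδ r
    refine (h5i x hx₅ M N Q R hMN hN1 hN2 hQ hR hQR hthr M₁ M₂ β γ δ hγ' hδ').trans ?_
    have hM0 : 0 ≤ M := by
      have hT : 0 ≤ thm5Threshold x Q R := le_trans (by linarith) (le_trans (le_max_left _ _) (le_max_left _ _))
      have := mul_nonneg (Real.rpow_nonneg (by linarith : (0:ℝ) ≤ x) (ε / 2)) hT
      linarith
    calc C' * Real.sqrt (l2Sq N β) * x ^ (1 / 2 - ε') * M ^ (1 / 2 : ℝ)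
        ≤ C₅ * Real.sqrt (l2Sq N β) * x ^ (1 / 2 - ε') * M ^ (1 / 2 : ℝ) := by
          have h0 : 0 ≤ Real.sqrt (l2Sq N β) * x ^ (1 / 2 - ε') * M ^ (1 / 2 : ℝ) := by positivity
          calc C' * Real.sqrt (l2Sq N β) * x ^ (1 / 2 - ε') * M ^ (1 / 2 : ℝ)
              = C' * (Real.sqrt (l2Sq N β) * x ^ (1 / 2 - ε') * M ^ (1 / 2 : ℝ)) := by ring
            _ ≤ C₅ * (Real.sqrt (l2Sq N β) * x ^ (1 / 2 - ε') * M ^ (1 / 2 : ℝ)) :=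
                mul_le_mul_of_nonneg_right (le_max_left _ _) h0
            _ = _ := by ring
      _ ≤ C₅ * Real.sqrt (l2Sq N β) * x ^ (1 / 2 - εs) * M ^ (1 / 2 : ℝ) := by
          refine mul_le_mul_of_nonneg_right (mul_le_mul_of_nonneg_left
            (Real.rpow_le_rpow_of_exponent_le hx1 (by linarith)) (by positivity)) (by positivity)
  obtain ⟨x₀, hx₀⟩ := core_bound a hε hA ⌈B⌉₊ hεs0 hεsε hεs4 hC₅0 h5'
  refine ⟨8 * 2, max x₀ 1, fun x hx M N Q R hMN hN1 hN2 hQ hR hQR hthr z hz M₁ M₂ β γ δ hγ hδ => ?_⟩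
  have hx₀' : x₀ ≤ x := le_trans (le_max_left _ _) hx
  have hx1 : 1 ≤ x := le_trans (le_max_right _ _) hx
  have hx0 : 0 < x := by linarith
  have hxε : 0 < x ^ ε := Real.rpow_pos_of_pos hx0 ε
  have hTQ : Q ≤ thm5Threshold x Q R := le_trans (le_max_left _ _) (le_max_left _ _)
  have hM0 : 0 < M := lt_of_le_of_lt (mul_nonneg hxε.le (le_trans (by linarith) hTQ)) hthr
  have hγ' := abs_le_sigma_pow_ceil hB hγ
  have hδ' := abs_le_sigma_pow_ceil hB hδ
  -- clamp the box and split the signs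
  rw [dispD_box_clamp a hM0.le]
  obtain ⟨hMu, huv, hv⟩ := clamp_bounds hM0.le M₁ M₂
  have hX : 0 ≤ x ^ (1 / 2 : ℝ) * M ^ (1 / 2 : ℝ) / Real.log x ^ A := by
    have : 0 ≤ Real.log x := Real.log_nonneg hx1
    positivity
  have key := abs_dispD_le_of_nonneg (a := a) (M := M) (N := N) (Q := Q) (R := R)
    (α := fun m => if max M (min M₁ (2 * M)) < (m : ℝ) ∧ (m : ℝ) ≤ max (max M (min M₁ (2 * M))) (min M₂ (2 * M))
      then roughIndicator z m else 0)
    (G := fun q => (σ 0 q : ℝ) ^ ⌈B⌉₊) (H := fun r => (σ 0 r : ℝ) ^ ⌈B⌉₊) (C := 2)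
    (X := x ^ (1 / 2 : ℝ) * M ^ (1 / 2 : ℝ) / Real.log x ^ A) (by norm_num) hX ?_ β γ δ hγ' hδ'
  · refine key.trans (le_of_eq ?_); ring
  · intro β' γ' δ' hβ' hγ'0 hδ'0 hγ'B hδ'B
    rw [dispD_box_eq_boxSum a hM0.le hMu huv hv]
    have h := hx₀ x hx₀' M N Q R hMN hN1 hN2 hQ hR hQR hthr z hz _ _ hMu huv hv β' γ' δ' hβ' hγ'0 hδ'0 hγ'B hδ'B
    refine h.trans (le_of_eq ?_); ring

/-- **The printed Theorem 5* from the printed Theorem 5** (BFI §12, p. 238: "Theorem 5* can be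
easily derived from Theorem 5"): the named fact
`Literature.NumberTheory.Sieve.BombieriFriedlanderIwaniecTheorem5Star` follows from
`Literature.NumberTheory.Sieve.BombieriFriedlanderIwaniecTheorem5`, through the boxed form
(`…Theorem5StarInterval_of_theorem5`) and `…Theorem5StarInterval.theorem5Star`.
[cite: BombieriFriedlanderIwaniecActa1986, §12 Theorem 5* p. 238] -/
theorem BombieriFriedlanderIwaniecTheorem5Star_of_theorem5 (h5 : BombieriFriedlanderIwaniecTheorem5) :
    BombieriFriedlanderIwaniecTheorem5Star :=
  (BombieriFriedlanderIwaniecTheorem5StarInterval_of_theorem5 h5).theorem5Star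

end Literature.NumberTheory.Sieve
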